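import Literature.Analysis.FluidPDE.TaoY6ChainGeometry
import Literature.Analysis.FluidPDE.PoincareBall
import Mathlib.Analysis.Calculus.ParametricIntegral
import Mathlib.Analysis.InnerProductSpace.Calculus
import HarnessLib

/-!
# Tao (2011/2013), proof of Thm. 10.1, the term `Y₆`: the chaining estimate for the Whitney
# averages of the vorticity — continuous radial version

Analysis/FluidPDE support file for the discharge of the named fact
`Literature.Analysis.FluidPDE.tao2011_nonlinearEstimate` (T. Tao, *Localisation and compactness
properties of the Navier–Stokes global regularity problem*, arXiv:1108.1165, §10, proof of
Thm. 10.1, the nonlinear term `Y₆`, in the annular geometry of Remark 10.6). After the Whitney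
decomposition, the local Biot–Savart law and Sobolev's inequality on the Whitney balls, the
estimate of `Y₆,₁` reduces ((10.21), arXiv p. 33) to the two sums
`c^{-0.1}δ² Σᵢ rᵢ³wᵢ‖∇ω‖²_{L²(3Bᵢ)}` and `c^{-0.1}δ² Σᵢ rᵢ⁴wᵢ³`,
`wᵢ = (|3Bᵢ|⁻¹∫_{3Bᵢ}|ω|²)^{1/2}`; the first is local, the second is "trickier to handle" and
is bounded there by the **parent-ball chaining**: Poincaré comparisons
`|wᵢ − wⱼ| ≲ rᵢ^{-1/2}‖∇ω‖_{L²(10Bᵢ)}` of intersecting balls, parents `B_{p(i)}`, ancestors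
`B_{a(i)}`, Hölder with the weights `(1+k)^{10}` and two counting lemmas, giving
"`c^{-0.1}δ² Σᵢ rᵢ⁴wᵢ³ ≲ c^{-0.15}δ³W^{3/2} + c^{0.05}δ^{-1}W^{1/2}Y₁`".

This file proves that bound for the *continuous* Whitney decomposition of the tree
(`FluidPDE/TaoWhitneyKernel`: depth `d = annDepth`, radius `ρ = whitneyRadius = min(d, k⁻¹)/100`,
cutoff `η = annularRamp k a b |· − x₀| = 100 k ρ`, slope `k = c^{-0.1}δ²`), in which
`Σᵢ rᵢ⁴wᵢ³ ↔ ∫ ρ(y)⁻³ · ρ(y)⁴ A(y)^{3/2} dy` with `A(y) = ⨍_{B(y, Mρ(y))}|ω|²`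
(`whitneyAvg`, any `0 < M ≤ 50`), for an arbitrary `C¹` map `f` in place of `ω`
(`whitney_radial_chaining`):

  `k ∫_Ω ρ A^{3/2} ≤ K₁(M) (W k³)^{1/2} W + K₂(M) (W/k)^{1/2} Y`,
  `W = ∫‖f‖²η`, `Y = ∫‖Df‖²η`,

with explicit constants `chainK₁`, `chainK₂`; `whitney_radial_chaining_curl` is the form with
`f = curl u`, `W ↦ 2·localisedEnstrophy`, `Y ≤ localisedEnstrophyDissipation`.

The proof replaces the discrete chain by **transport along straight inward paths**, which needs
neither Poincaré's inequality nor any combinatorics: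

* `ballAvg_transport` (the path lemma): for the moving averages
  `h(τ) = ⨍_{B̄(0,1)}‖f(c(τ) + r(τ)v)‖²dv`, `G(τ) = ⨍‖Df(…)‖²`, with speed `‖c'‖ + |r'| ≤ V`, one
  has `|h'| ≤ 2V⨍‖f‖‖Df‖ ≤ V(h/λ + λG)` (differentiation under the integral sign,
  `hasDerivAt_ballAvg_norm_sq`); for a weight `s > 0` with `s' ≥ σ₀ > 0` the function
  `s (h+ε)^{3/2} + (9V²/4σ₀)∫₀ s²(h+ε)^{1/2}G` is monotone (its derivative is a square at the
  scale `λ = 3sV/2σ₀`), whence `s(0)h(0)^{3/2} ≤ s(τ₁)h(τ₁)^{3/2} + (9V²/4σ₀)∫₀^{τ₁} s²h^{1/2}G`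
  (`scalar_transport`, `ε → 0`);
* geometry (`GoodPath`, `goodPath_of_mem_layer`): from a point `y` of the layer `0 < d < k⁻¹/8`,
  every straight path `y + τv`, `v` within `1/4` of the inward radial direction (`inwardDir`),
  `0 ≤ τ ≤ k⁻¹/2`, has depth growing at a rate in `[1/4, 5/4]` and equal to `100ρ`
  (this uses `0 < a` and `a + 2k⁻¹ < b`);
* averaging the transport inequality over the endpoints `τ₁ ∈ [k⁻¹/4, k⁻¹/2]` and the directions
  (`lintegral_transport_of_mem_layer`), Tonelli, translation invariance of Lebesgue measure in the
  innermost integral (`lintegral_chainStart_comp_le`: the points `y + τv` land in the shell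
  `τ/4 ≤ d ≤ k⁻¹/8 + 5τ/4`), the time each point spends in the shells
  (`lintegral_indicator_chainShell_le`), the sup bound (10.23) for the averages (`whitneyAvg_le`)
  and the overlap bounds of the continuous Whitney decomposition
  (`lintegral_whitneyAvg_plateau_le`, `lintegral_depth_whitneyAvg_layer_le`, from
  `TaoWhitneyKernel.lintegral_whitneyKernel_le`) give the two terms; the plateau `d ≥ k⁻¹/8` is
  direct (`lintegral_plateau_le`).

## Mathlib / tree search

Tree: `annDepth`, `whitneyRadius`, `whitneyKernel`, `lintegral_whitneyKernel_le`,
`mul_setIntegral_whitneyBall_le`, `annularRamp_eq_mul_whitneyRadius` (`TaoWhitneyKernel`);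
`annDepth_eq_inner/outer`, `whitneyRadius_eq_of_le` (`TaoY6ChainGeometry`);
`lintegral_comp_smul_add` (`PoincareBall`); `localisedEnstrophy(Dissipation)`,
`sq_opNorm_le_frobeniusNormSq`, `contDiff_curl`. A sibling route to the same step through a
Whitney-scale mass bound exists in `TaoY6WhitneyMass`/`TaoY6AnnulusChain` (landed while this file
was written); the present file gives Tao's two-term form of (10.21) directly. Mathlib:
`hasDerivAt_integral_of_dominated_loc_of_deriv_le`, `continuous_parametric_integral_of_continuous`,
`monotoneOn_of_hasDerivWithinAt_nonneg`, `intervalIntegral.integral_hasDerivAt_right`,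
`lintegral_add_right_eq_self`, `lintegral_lintegral_swap`, `Measure.setIntegral_comp_smul_of_pos`,
`HasDerivAt.norm_sq`, `Measure.addHaar_sphere`.

## References

* T. Tao, *Localisation and compactness properties of the Navier–Stokes global regularity
  problem*, Anal. PDE 6 (2013) 25–107 = arXiv:1108.1165 (`Tao2011`), §10, proof of Thm. 10.1
  (arXiv pp. 32–33: the Whitney decomposition, (10.20)–(10.23), and the chaining argument
  "Now for any small ball `Bᵢ`, we may assign a 'parent' ball …" to "… `≲ c^{0.05}δ^{-1}W^{1/2}Y₁`")
  and Remark 10.6 (arXiv Rem. 64) for the annular geometry.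
* E. M. Stein, *Singular integrals and differentiability properties of functions* (1970),
  Ch. VI §1 (Whitney decompositions).
-/

noncomputable section

open MeasureTheory Set Function Filter Metric Topology
open scoped ENNReal NNReal RealInnerProductSpace

namespace Literature.Analysis.FluidPDE

/-- Local notation for physical space `ℝ³ = EuclideanSpace ℝ (Fin 3)`. -/
local notation "ℝ³" => EuclideanSpace ℝ (Fin 3)

/-! ## Averages over balls, written on the closed unit ball -/

section BallAvg

/-- The volume of the closed unit ball of `ℝ³`, as a real number. [folklore] -/
def unitBallVol : ℝ := (volume (closedBall (0 : ℝ³) 1)).toReal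

/-- `vol B̄(0,1) > 0`. [folklore] -/
theorem unitBallVol_pos : 0 < unitBallVol :=
  ENNReal.toReal_pos (measure_closedBall_pos volume (0 : ℝ³) one_pos).ne'
    (measure_closedBall_lt_top).ne

/-- The **ball average on the unit ball**: `ballAvg g z r = ⨍_{B̄(0,1)} g(z + r v) dv`, i.e. the
average of `g` over `B(z, r)` when `r > 0`, and `g(z)` when `r = 0`; written this way it is
manifestly continuous in `(z, r)`. [folklore] -/
def ballAvg (g : ℝ³ → ℝ) (z : ℝ³) (r : ℝ) : ℝ :=
  unitBallVol⁻¹ * ∫ v in closedBall (0 : ℝ³) 1, g (z + r • v)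

/-- Unfolding `ballAvg`. [folklore] -/
theorem ballAvg_def (g : ℝ³ → ℝ) (z : ℝ³) (r : ℝ) :
    ballAvg g z r = unitBallVol⁻¹ * ∫ v in closedBall (0 : ℝ³) 1, g (z + r • v) := rfl

/-- Averages of nonnegative functions are nonnegative. [folklore] -/
theorem ballAvg_nonneg {g : ℝ³ → ℝ} (hg : ∀ x, 0 ≤ g x) (z : ℝ³) (r : ℝ) : 0 ≤ ballAvg g z r :=
  mul_nonneg (inv_nonneg.2 unitBallVol_pos.le) (setIntegral_nonneg measurableSet_closedBall
    fun _ _ => hg _)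

/-- **Joint continuity of the ball average** in centre and radius, for continuous `g`. [folklore] -/
theorem continuous_ballAvg {g : ℝ³ → ℝ} (hg : Continuous g) :
    Continuous fun p : ℝ³ × ℝ => ballAvg g p.1 p.2 := by
  unfold ballAvg
  refine continuous_const.mul ?_
  have h : Continuous (uncurry fun (p : ℝ³ × ℝ) (v : ℝ³) => g (p.1 + p.2 • v)) := by
    exact hg.comp ((continuous_fst.comp continuous_fst).add
      ((continuous_snd.comp continuous_fst).smul continuous_snd))
  exact continuous_parametric_integral_of_continuous h (isCompact_closedBall (0 : ℝ³) 1)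

/-- Continuity of the ball average along continuous centre and radius maps. [folklore] -/
theorem continuous_ballAvg_comp {X : Type*} [TopologicalSpace X] {g : ℝ³ → ℝ} (hg : Continuous g)
    {z : X → ℝ³} {r : X → ℝ} (hz : Continuous z) (hr : Continuous r) :
    Continuous fun x => ballAvg g (z x) (r x) :=
  (continuous_ballAvg hg).comp (hz.prodMk hr)

/-- Linearity: `ballAvg (c g) = c ballAvg g`. [folklore] -/
theorem ballAvg_const_mul (c : ℝ) (g : ℝ³ → ℝ) (z : ℝ³) (r : ℝ) :
    ballAvg (fun x => c * g x) z r = c * ballAvg g z r := by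
  rw [ballAvg_def, ballAvg_def, integral_const_mul]
  ring

/-- Monotonicity of the ball average (for integrable integrands on the unit ball). [folklore] -/
theorem ballAvg_mono {g₁ g₂ : ℝ³ → ℝ} {z : ℝ³} {r : ℝ}
    (h₁ : IntegrableOn (fun v => g₁ (z + r • v)) (closedBall (0 : ℝ³) 1))
    (h₂ : IntegrableOn (fun v => g₂ (z + r • v)) (closedBall (0 : ℝ³) 1))
    (h : ∀ x, g₁ x ≤ g₂ x) : ballAvg g₁ z r ≤ ballAvg g₂ z r :=
  mul_le_mul_of_nonneg_left (setIntegral_mono h₁ h₂ fun _ => h _)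
    (inv_nonneg.2 unitBallVol_pos.le)

/-- A continuous integrand is integrable on the unit ball after the affine reparametrisation. [folklore] -/
theorem integrableOn_comp_affine_unitBall {g : ℝ³ → ℝ} (hg : Continuous g) (z : ℝ³) (r : ℝ) :
    IntegrableOn (fun v => g (z + r • v)) (closedBall (0 : ℝ³) 1) := by
  have hc : Continuous fun v : ℝ³ => g (z + r • v) := by fun_prop
  exact hc.continuousOn.integrableOn_compact (isCompact_closedBall (0 : ℝ³) 1)

/-- **The ball average is the average over the ball** (`r > 0`):
`ballAvg g z r = (r³ vol B̄(0,1))⁻¹ ∫_{B̄(z, r)} g`. [folklore] -/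
theorem ballAvg_eq_of_pos (g : ℝ³ → ℝ) (z : ℝ³) {r : ℝ} (hr : 0 < r) :
    ballAvg g z r = (r ^ 3 * unitBallVol)⁻¹ * ∫ x in closedBall z r, g x := by
  rw [ballAvg_def]
  have h1 : ∫ v in closedBall (0 : ℝ³) 1, g (z + r • v) =
      (r ^ 3)⁻¹ * ∫ x in closedBall (0 : ℝ³) r, g (z + x) := by
    have h := Measure.setIntegral_comp_smul_of_pos volume (fun w => g (z + w)) (closedBall (0 : ℝ³) 1) hr
    rw [finrank_euclideanSpace_fin, smul_closedBall r (0 : ℝ³) zero_le_one, smul_zero,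
      Real.norm_of_nonneg hr.le, mul_one, smul_eq_mul] at h
    exact h
  have h2 : ∫ x in closedBall (0 : ℝ³) r, g (z + x) = ∫ x in closedBall z r, g x := by
    rw [← integral_indicator measurableSet_closedBall, ← integral_indicator measurableSet_closedBall]
    have e : (fun x => (closedBall (0 : ℝ³) r).indicator (fun x => g (z + x)) x) =
        fun x => (closedBall z r).indicator g (z + x) := by
      funext x
      by_cases hx : x ∈ closedBall (0 : ℝ³) r
      · have hx' : z + x ∈ closedBall z r := by
          rw [mem_closedBall, dist_eq_norm, add_sub_cancel_left]; rwa [mem_closedBall_zero_iff] at hx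
        rw [indicator_of_mem hx, indicator_of_mem hx']
      · have hx' : z + x ∉ closedBall z r := by
          rw [mem_closedBall, dist_eq_norm, add_sub_cancel_left]; rwa [mem_closedBall_zero_iff] at hx
        rw [indicator_of_notMem hx, indicator_of_notMem hx']
    rw [e]
    exact integral_add_left_eq_self _ z
  rw [h1, h2, mul_inv, ← mul_assoc, mul_comm (unitBallVol⁻¹)]

/-- Closed and open balls agree up to a null set (`r > 0`, Lebesgue measure on `ℝ³`). [folklore] -/
theorem closedBall_ae_eq_ball_three (z : ℝ³) (r : ℝ) :
    (closedBall z r : Set ℝ³) =ᵐ[volume] ball z r := by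
  refine (ae_eq_set).2 ⟨?_, ?_⟩
  · rw [closedBall_sdiff_ball]
    exact Measure.addHaar_sphere volume z r
  · rw [sdiff_eq_empty.2 ball_subset_closedBall, measure_empty]

/-- The ball average over the open ball (`r > 0`). [folklore] -/
theorem ballAvg_eq_of_pos' (g : ℝ³ → ℝ) (z : ℝ³) {r : ℝ} (hr : 0 < r) :
    ballAvg g z r = (r ^ 3 * unitBallVol)⁻¹ * ∫ x in ball z r, g x := by
  rw [ballAvg_eq_of_pos g z hr, setIntegral_congr_set (closedBall_ae_eq_ball_three z r)]

end BallAvg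

/-! ## Transport of ball averages along a moving ball (the path lemma) -/

section Path

variable {F : Type*} [NormedAddCommGroup F] [InnerProductSpace ℝ F]

/-- Derivative of `σ ↦ ‖f(c(σ) + r(σ) v)‖²` along `C¹` centre and radius maps. [folklore] -/
theorem hasDerivAt_norm_sq_comp_affine {f : ℝ³ → F} (hf : ContDiff ℝ 1 f) {c : ℝ → ℝ³}
    {r : ℝ → ℝ} {c' : ℝ³} {r' τ : ℝ} (hc : HasDerivAt c c' τ) (hr : HasDerivAt r r' τ) (v : ℝ³) :
    HasDerivAt (fun σ => ‖f (c σ + r σ • v)‖ ^ 2)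
      (2 * ⟪f (c τ + r τ • v), fderiv ℝ f (c τ + r τ • v) (c' + r' • v)⟫) τ := by
  have h1 : HasDerivAt (fun σ => c σ + r σ • v) (c' + r' • v) τ := hc.add (hr.smul_const v)
  have h2 : HasDerivAt (fun σ => f (c σ + r σ • v)) (fderiv ℝ f (c τ + r τ • v) (c' + r' • v)) τ :=
    ((hf.differentiable one_ne_zero) _).hasFDerivAt.comp_hasDerivAt τ h1
  exact h2.norm_sq

/-- Size of the derivative of the integrand: `|2⟪f(x), Df(x)w⟫| ≤ 2‖f(x)‖‖Df(x)‖‖w‖`. [folklore] -/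
theorem abs_two_mul_inner_fderiv_le {f : ℝ³ → F} (x w : ℝ³) :
    |2 * ⟪f x, fderiv ℝ f x w⟫| ≤ 2 * (‖f x‖ * ‖fderiv ℝ f x‖) * ‖w‖ := by
  rw [abs_mul, abs_two]
  have h := abs_real_inner_le_norm (f x) (fderiv ℝ f x w)
  have h2 := (fderiv ℝ f x).le_opNorm w
  nlinarith [norm_nonneg (f x), norm_nonneg (fderiv ℝ f x)]

/-- On the unit ball the velocity of the moving point is at most `‖c'‖ + |r'|`. [folklore] -/
theorem norm_add_smul_le_of_mem_closedBall {c' v : ℝ³} {r' : ℝ} (hv : v ∈ closedBall (0 : ℝ³) 1) :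
    ‖c' + r' • v‖ ≤ ‖c'‖ + |r'| := by
  rw [mem_closedBall_zero_iff] at hv
  calc ‖c' + r' • v‖ ≤ ‖c'‖ + ‖r' • v‖ := norm_add_le _ _
    _ = ‖c'‖ + |r'| * ‖v‖ := by rw [norm_smul, Real.norm_eq_abs]
    _ ≤ ‖c'‖ + |r'| := by nlinarith [abs_nonneg r', norm_nonneg v]

/-- **Differentiation of the moving ball average.** For `f ∈ C¹`, continuous centre and radius
maps `c`, `r` that are differentiable on an open interval with `‖c'‖ + |r'| ≤ V` there, the
average `h(σ) = ⨍_{B̄(0,1)} ‖f(c(σ) + r(σ)v)‖² dv` is differentiable at every point of the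
interval, with `|h'| ≤ 2V ⨍ ‖f‖‖Df‖` (differentiation under the integral sign). [folklore] -/
theorem hasDerivAt_ballAvg_norm_sq {f : ℝ³ → F} (hf : ContDiff ℝ 1 f) {c : ℝ → ℝ³} {r : ℝ → ℝ}
    {c' : ℝ → ℝ³} {r' : ℝ → ℝ} {t₁ t₂ τ V : ℝ} (hτ : τ ∈ Ioo t₁ t₂)
    (hcc : Continuous c) (hrc : Continuous r)
    (hc : ∀ σ ∈ Ioo t₁ t₂, HasDerivAt c (c' σ) σ) (hr : ∀ σ ∈ Ioo t₁ t₂, HasDerivAt r (r' σ) σ)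
    (hV : ∀ σ ∈ Ioo t₁ t₂, ‖c' σ‖ + |r' σ| ≤ V) :
    ∃ D : ℝ, HasDerivAt (fun σ => ballAvg (fun x => ‖f x‖ ^ 2) (c σ) (r σ)) D τ ∧
      |D| ≤ 2 * V * ballAvg (fun x => ‖f x‖ * ‖fderiv ℝ f x‖) (c τ) (r τ) := by
  set μ : Measure ℝ³ := volume.restrict (closedBall (0 : ℝ³) 1) with hμ
  haveI : IsFiniteMeasure μ := by
    rw [hμ]; exact ⟨by rw [Measure.restrict_apply_univ]; exact measure_closedBall_lt_top⟩
  set Φ : ℝ → ℝ³ → ℝ := fun σ v => ‖f (c σ + r σ • v)‖ ^ 2 with hΦ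
  set Φ' : ℝ → ℝ³ → ℝ := fun σ v =>
    2 * ⟪f (c σ + r σ • v), fderiv ℝ f (c σ + r σ • v) (c' σ + r' σ • v)⟫ with hΦ'
  have hfc : Continuous f := hf.continuous
  have hDfc : Continuous (fderiv ℝ f) := hf.continuous_fderiv one_ne_zero
  have hV0 : 0 ≤ V := le_trans (by positivity) (hV τ hτ)
  -- uniform bounds for `f` and `Df` on the compact set swept by the moving ball
  have hK : IsCompact ((Icc t₁ t₂ ×ˢ closedBall (0 : ℝ³) 1).image
      (fun p : ℝ × ℝ³ => c p.1 + r p.1 • p.2)) :=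
    ((isCompact_Icc.prod (isCompact_closedBall _ _)).image (by fun_prop))
  obtain ⟨Bf, hBf⟩ := hK.exists_bound_of_continuousOn hfc.continuousOn
  obtain ⟨BD, hBD⟩ := hK.exists_bound_of_continuousOn hDfc.continuousOn
  have hBf0 : 0 ≤ Bf := le_trans (norm_nonneg _) (hBf _ ⟨(τ, 0), ⟨Ioo_subset_Icc_self hτ,
    mem_closedBall_self zero_le_one⟩, rfl⟩)
  have hmem : ∀ σ ∈ Ioo t₁ t₂, ∀ v ∈ closedBall (0 : ℝ³) 1,
      c σ + r σ • v ∈ (Icc t₁ t₂ ×ˢ closedBall (0 : ℝ³) 1).image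
        (fun p : ℝ × ℝ³ => c p.1 + r p.1 • p.2) :=
    fun σ hσ v hv => ⟨(σ, v), ⟨Ioo_subset_Icc_self hσ, hv⟩, rfl⟩
  have key := hasDerivAt_integral_of_dominated_loc_of_deriv_le (μ := μ) (F := Φ) (F' := Φ')
    (x₀ := τ) (bound := fun _ => 2 * (Bf * BD) * V) (Ioo_mem_nhds hτ.1 hτ.2)
    (Eventually.of_forall fun σ => (Continuous.aestronglyMeasurable (by rw [hΦ]; fun_prop)))
    (by rw [hμ]; exact integrableOn_comp_affine_unitBall (hfc.norm.pow 2) _ _)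
    (Continuous.aestronglyMeasurable (by
      rw [hΦ']
      exact continuous_const.mul (((hfc.comp (by fun_prop)).inner
        (((hDfc.comp (by fun_prop : Continuous fun v : ℝ³ => c τ + r τ • v)).clm_apply
          (by fun_prop)))))))
    (by
      rw [hμ, ae_restrict_iff' measurableSet_closedBall]
      refine Eventually.of_forall fun v hv σ hσ => ?_
      rw [hΦ', Real.norm_eq_abs]
      refine (abs_two_mul_inner_fderiv_le _ _).trans ?_
      have h1 := hBf _ (hmem σ hσ v hv)
      have h2 := hBD _ (hmem σ hσ v hv)
      have h3 := (norm_add_smul_le_of_mem_closedBall (c' := c' σ) (r' := r' σ) hv).trans (hV σ hσ)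
      have h4 : ‖f (c σ + r σ • v)‖ * ‖fderiv ℝ f (c σ + r σ • v)‖ ≤ Bf * BD :=
        mul_le_mul h1 h2 (norm_nonneg _) hBf0
      have h5 : 0 ≤ ‖f (c σ + r σ • v)‖ * ‖fderiv ℝ f (c σ + r σ • v)‖ := by positivity
      nlinarith [norm_nonneg (c' σ + r' σ • v)])
    (integrable_const _)
    (Eventually.of_forall fun v σ hσ => by
      rw [hΦ, hΦ']
      exact hasDerivAt_norm_sq_comp_affine hf (hc σ hσ) (hr σ hσ) v)
  refine ⟨unitBallVol⁻¹ * ∫ v, Φ' τ v ∂μ, ?_, ?_⟩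
  · have e : (fun σ => ballAvg (fun x => ‖f x‖ ^ 2) (c σ) (r σ)) =
        fun σ => unitBallVol⁻¹ * ∫ v, Φ σ v ∂μ := by
      funext σ; rw [ballAvg_def]
    rw [e]
    exact key.2.const_mul _
  · rw [abs_mul, abs_of_pos (inv_pos.2 unitBallVol_pos), ballAvg_def, ← mul_assoc,
      mul_comm (2 * V), mul_assoc]
    refine mul_le_mul_of_nonneg_left ?_ (inv_nonneg.2 unitBallVol_pos.le)
    rw [← integral_const_mul, ← Real.norm_eq_abs]
    refine norm_integral_le_of_norm_le ((integrableOn_comp_affine_unitBall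
      (hfc.norm.mul hDfc.norm) (c τ) (r τ)).const_mul _) ?_
    rw [hμ, ae_restrict_iff' measurableSet_closedBall]
    refine Eventually.of_forall fun v hv => ?_
    rw [hΦ', Real.norm_eq_abs]
    refine (abs_two_mul_inner_fderiv_le _ _).trans ?_
    have h3 := (norm_add_smul_le_of_mem_closedBall (c' := c' τ) (r' := r' τ) hv).trans (hV τ hτ)
    have h5 : 0 ≤ ‖f (c τ + r τ • v)‖ * ‖fderiv ℝ f (c τ + r τ • v)‖ := by positivity
    nlinarith

/-- Additivity of the ball average (continuous integrands). [folklore] -/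
theorem ballAvg_add {g₁ g₂ : ℝ³ → ℝ} (h₁ : Continuous g₁) (h₂ : Continuous g₂) (z : ℝ³) (r : ℝ) :
    ballAvg (fun x => g₁ x + g₂ x) z r = ballAvg g₁ z r + ballAvg g₂ z r := by
  rw [ballAvg_def, ballAvg_def, ballAvg_def, ← mul_add, ← integral_add
    (integrableOn_comp_affine_unitBall h₁ z r) (integrableOn_comp_affine_unitBall h₂ z r)]

/-- **Young's inequality for the averages**: `2 ⨍‖f‖‖Df‖ ≤ λ⁻¹ ⨍‖f‖² + λ ⨍‖Df‖²` (`λ > 0`). [folklore] -/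
theorem two_mul_ballAvg_norm_mul_le {f : ℝ³ → F} (hf : ContDiff ℝ 1 f) (z : ℝ³) (r : ℝ) {lam : ℝ}
    (hlam : 0 < lam) :
    2 * ballAvg (fun x => ‖f x‖ * ‖fderiv ℝ f x‖) z r ≤
      ballAvg (fun x => ‖f x‖ ^ 2) z r / lam + lam * ballAvg (fun x => ‖fderiv ℝ f x‖ ^ 2) z r := by
  have hfc : Continuous f := hf.continuous
  have hDfc : Continuous (fderiv ℝ f) := hf.continuous_fderiv one_ne_zero
  have i1 := integrableOn_comp_affine_unitBall (g := fun x => ‖f x‖ * ‖fderiv ℝ f x‖)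
    (hfc.norm.mul hDfc.norm) z r
  have i2 := integrableOn_comp_affine_unitBall (g := fun x => ‖f x‖ ^ 2) (hfc.norm.pow 2) z r
  have i3 := integrableOn_comp_affine_unitBall (g := fun x => ‖fderiv ℝ f x‖ ^ 2)
    (hDfc.norm.pow 2) z r
  have hpt : ∀ v : ℝ³, 2 * (‖f (z + r • v)‖ * ‖fderiv ℝ f (z + r • v)‖) ≤
      lam⁻¹ * ‖f (z + r • v)‖ ^ 2 + lam * ‖fderiv ℝ f (z + r • v)‖ ^ 2 := by
    intro v
    have key : 0 ≤ (‖f (z + r • v)‖ - lam * ‖fderiv ℝ f (z + r • v)‖) ^ 2 := sq_nonneg _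
    rw [← sub_nonneg]
    have e : lam⁻¹ * ‖f (z + r • v)‖ ^ 2 + lam * ‖fderiv ℝ f (z + r • v)‖ ^ 2 -
        2 * (‖f (z + r • v)‖ * ‖fderiv ℝ f (z + r • v)‖) =
        lam⁻¹ * (‖f (z + r • v)‖ - lam * ‖fderiv ℝ f (z + r • v)‖) ^ 2 := by
      field_simp
      ring
    rw [e]
    exact mul_nonneg (inv_nonneg.2 hlam.le) key
  have hint : ∫ v in closedBall (0 : ℝ³) 1, 2 * (‖f (z + r • v)‖ * ‖fderiv ℝ f (z + r • v)‖) ≤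
      ∫ v in closedBall (0 : ℝ³) 1, (lam⁻¹ * ‖f (z + r • v)‖ ^ 2 + lam * ‖fderiv ℝ f (z + r • v)‖ ^ 2) :=
    setIntegral_mono (i1.const_mul 2) ((i2.const_mul _).add (i3.const_mul _)) hpt
  rw [integral_const_mul, integral_add (i2.const_mul _) (i3.const_mul _), integral_const_mul,
    integral_const_mul] at hint
  rw [ballAvg_def, ballAvg_def, ballAvg_def]
  have hκ := inv_nonneg.2 unitBallVol_pos.le
  have := mul_le_mul_of_nonneg_left hint hκ
  have e2 : unitBallVol⁻¹ * (lam⁻¹ * ∫ v in closedBall (0 : ℝ³) 1, ‖f (z + r • v)‖ ^ 2) +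
      unitBallVol⁻¹ * (lam * ∫ v in closedBall (0 : ℝ³) 1, ‖fderiv ℝ f (z + r • v)‖ ^ 2) =
      unitBallVol⁻¹ * (∫ v in closedBall (0 : ℝ³) 1, ‖f (z + r • v)‖ ^ 2) / lam +
        lam * (unitBallVol⁻¹ * ∫ v in closedBall (0 : ℝ³) 1, ‖fderiv ℝ f (z + r • v)‖ ^ 2) := by
    rw [div_eq_mul_inv]; ring
  linarith [e2]

/-- **Scalar transport lemma** (the continuity argument behind the chaining): if `h, G ≥ 0` and
`s > 0` are continuous on `[0, τ₁]`, differentiable inside with `s' ≥ σ₀ > 0` and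
`|h'| ≤ V (h/λ + λ G)` for every `λ > 0`, then
`s(0) h(0)^{3/2} ≤ s(τ₁) h(τ₁)^{3/2} + (9V²/4σ₀) ∫₀^{τ₁} s² h^{1/2} G`: the function
`s (h+ε)^{3/2} + (9V²/4σ₀) ∫₀ s² (h+ε)^{1/2} G` is monotone (its derivative is a square), and
`ε → 0`. [folklore] -/
theorem scalar_transport {h G s h' s' : ℝ → ℝ} {τ₁ V σ₀ : ℝ} (hτ₁ : 0 < τ₁) (hσ₀ : 0 < σ₀)
    (hV : 0 ≤ V) (hhc : Continuous h) (hGc : Continuous G) (hsc : Continuous s)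
    (hh0 : ∀ σ, 0 ≤ h σ) (hG0 : ∀ σ, 0 ≤ G σ)
    (hh : ∀ σ ∈ Ioo 0 τ₁, HasDerivAt h (h' σ) σ) (hs : ∀ σ ∈ Ioo 0 τ₁, HasDerivAt s (s' σ) σ)
    (hbound : ∀ σ ∈ Ioo 0 τ₁, ∀ lam : ℝ, 0 < lam → |h' σ| ≤ V * (h σ / lam + lam * G σ))
    (hs' : ∀ σ ∈ Ioo 0 τ₁, σ₀ ≤ s' σ) (hspos : ∀ σ ∈ Ioo 0 τ₁, 0 < s σ) :
    s 0 * (h 0 * Real.sqrt (h 0)) ≤ s τ₁ * (h τ₁ * Real.sqrt (h τ₁)) +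
      9 * V ^ 2 / (4 * σ₀) * ∫ σ in (0 : ℝ)..τ₁, s σ ^ 2 * (Real.sqrt (h σ) * G σ) := by
  set C : ℝ := 9 * V ^ 2 / (4 * σ₀) with hC
  have hC0 : 0 ≤ C := by rw [hC]; positivity
  -- the regularised comparison, for every `ε > 0`
  have hreg : ∀ ε : ℝ, 0 < ε →
      s 0 * ((h 0 + ε) * Real.sqrt (h 0 + ε)) ≤ s τ₁ * ((h τ₁ + ε) * Real.sqrt (h τ₁ + ε)) +
        C * ∫ σ in (0 : ℝ)..τ₁, s σ ^ 2 * (Real.sqrt (h σ + ε) * G σ) := by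
    intro ε hε
    set I : ℝ → ℝ := fun σ => s σ ^ 2 * (Real.sqrt (h σ + ε) * G σ) with hI
    have hIc : Continuous I := by
      rw [hI]; exact (hsc.pow 2).mul ((hhc.add continuous_const).sqrt.mul hGc)
    set Φ : ℝ → ℝ := fun σ => s σ * ((h σ + ε) * Real.sqrt (h σ + ε)) +
      C * ∫ u in (0 : ℝ)..σ, I u with hΦ
    have hΦc : Continuous Φ := by
      rw [hΦ]
      exact (hsc.mul ((hhc.add continuous_const).mul (hhc.add continuous_const).sqrt)).add
        (continuous_const.mul (intervalIntegral.continuous_primitive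
          (fun a b => hIc.intervalIntegrable a b) 0))
    have hmono : MonotoneOn Φ (Icc 0 τ₁) := by
      refine monotoneOn_of_hasDerivWithinAt_nonneg (convex_Icc 0 τ₁) hΦc.continuousOn
        (f' := fun σ => s' σ * ((h σ + ε) * Real.sqrt (h σ + ε)) +
          s σ * (3 / 2 * Real.sqrt (h σ + ε) * h' σ) + C * I σ) ?_ ?_
      · intro σ hσ
        rw [interior_Icc] at hσ
        have hpos : 0 < h σ + ε := by linarith [hh0 σ]
        have hsq : Real.sqrt (h σ + ε) ≠ 0 := (Real.sqrt_pos.2 hpos).ne'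
        have h1 : HasDerivAt (fun u => (h u + ε) * Real.sqrt (h u + ε))
            (3 / 2 * Real.sqrt (h σ + ε) * h' σ) σ := by
          have ha : HasDerivAt (fun u => h u + ε) (h' σ) σ := (hh σ hσ).add_const ε
          have hb := ha.sqrt hpos.ne'
          refine (ha.mul hb).congr_deriv ?_
          have hx : Real.sqrt (h σ + ε) * Real.sqrt (h σ + ε) = h σ + ε := Real.mul_self_sqrt hpos.le
          have e1 : (h σ + ε) * (h' σ / (2 * Real.sqrt (h σ + ε))) = Real.sqrt (h σ + ε) * h' σ / 2 := by
            calc (h σ + ε) * (h' σ / (2 * Real.sqrt (h σ + ε)))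
                = ((h σ + ε) / Real.sqrt (h σ + ε)) * h' σ / 2 := by ring
              _ = Real.sqrt (h σ + ε) * h' σ / 2 := by rw [Real.div_sqrt]
          rw [e1]
          ring
        have h2 : HasDerivAt (fun u => ∫ w in (0 : ℝ)..u, I w) (I σ) σ :=
          intervalIntegral.integral_hasDerivAt_right (hIc.intervalIntegrable _ _)
            (hIc.stronglyMeasurableAtFilter _ _) hIc.continuousAt
        exact (((hs σ hσ).mul h1).add (h2.const_mul C)).hasDerivWithinAt
      · intro σ hσ
        rw [interior_Icc] at hσ
        have hpos : 0 < h σ + ε := by linarith [hh0 σ]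
        set X := Real.sqrt (h σ + ε) with hX
        have hX0 : 0 < X := Real.sqrt_pos.2 hpos
        have hX2 : X ^ 2 = h σ + ε := by rw [hX, Real.sq_sqrt hpos.le]
        have hsσ := hspos σ hσ
        have hs'σ := hs' σ hσ
        have hGσ := hG0 σ
        -- the derivative bound at the scale `λ = 3 s V / (2 σ₀)`
        have hD : s σ * (3 / 2 * X * |h' σ|) ≤ σ₀ * ((h σ + ε) * X) + C * (s σ ^ 2 * (X * G σ)) := by
          rcases hV.eq_or_lt with hV0 | hVpos
          · have hb := hbound σ hσ 1 one_pos
            rw [← hV0, zero_mul] at hb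
            have : |h' σ| = 0 := le_antisymm hb (abs_nonneg _)
            rw [this, mul_zero, mul_zero]
            positivity
          · set lam : ℝ := 3 * s σ * V / (2 * σ₀) with hlam
            have hlam0 : 0 < lam := by rw [hlam]; positivity
            have hb := hbound σ hσ lam hlam0
            have hb' : |h' σ| ≤ V * ((h σ + ε) / lam + lam * G σ) := by
              refine hb.trans (mul_le_mul_of_nonneg_left ?_ hV)
              gcongr
              linarith
            calc s σ * (3 / 2 * X * |h' σ|)
                ≤ s σ * (3 / 2 * X * (V * ((h σ + ε) / lam + lam * G σ))) := by gcongr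
              _ = σ₀ * ((h σ + ε) * X) + C * (s σ ^ 2 * (X * G σ)) := by
                  rw [hlam, hC]
                  field_simp
                  ring
        rw [hI]
        have habs : -(s σ * (3 / 2 * X * |h' σ|)) ≤ s σ * (3 / 2 * X * h' σ) := by
          have h1 : -|h' σ| ≤ h' σ := neg_abs_le _
          have h2 := mul_le_mul_of_nonneg_left h1 (by positivity : 0 ≤ s σ * (3 / 2 * X))
          linarith [h2]
        have hfirst : σ₀ * ((h σ + ε) * X) ≤ s' σ * ((h σ + ε) * X) :=
          mul_le_mul_of_nonneg_right hs'σ (by positivity)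
        linarith
    have := hmono (left_mem_Icc.2 hτ₁.le) (right_mem_Icc.2 hτ₁.le) hτ₁.le
    rw [hΦ] at this
    simp only [intervalIntegral.integral_same, mul_zero, add_zero] at this
    exact this
  -- `ε → 0⁺`
  have hIcont : Continuous (uncurry fun (ε σ : ℝ) => s σ ^ 2 * (Real.sqrt (h σ + ε) * G σ)) :=
    ((hsc.comp continuous_snd).pow 2).mul ((((hhc.comp continuous_snd).add continuous_fst).sqrt).mul
      (hGc.comp continuous_snd))
  have hL : Tendsto (fun ε : ℝ => s 0 * ((h 0 + ε) * Real.sqrt (h 0 + ε))) (𝓝[>] 0)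
      (𝓝 (s 0 * (h 0 * Real.sqrt (h 0)))) := by
    have hc : Continuous fun ε : ℝ => s 0 * ((h 0 + ε) * Real.sqrt (h 0 + ε)) := by fun_prop
    have := hc.tendsto 0
    rw [add_zero] at this
    exact this.mono_left nhdsWithin_le_nhds
  have hR : Tendsto (fun ε : ℝ => s τ₁ * ((h τ₁ + ε) * Real.sqrt (h τ₁ + ε)) +
      C * ∫ σ in (0 : ℝ)..τ₁, s σ ^ 2 * (Real.sqrt (h σ + ε) * G σ)) (𝓝[>] 0)
      (𝓝 (s τ₁ * (h τ₁ * Real.sqrt (h τ₁)) +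
        C * ∫ σ in (0 : ℝ)..τ₁, s σ ^ 2 * (Real.sqrt (h σ) * G σ))) := by
    have hc : Continuous fun ε : ℝ => s τ₁ * ((h τ₁ + ε) * Real.sqrt (h τ₁ + ε)) +
        C * ∫ σ in (0 : ℝ)..τ₁, s σ ^ 2 * (Real.sqrt (h σ + ε) * G σ) := by
      refine Continuous.add (by fun_prop) (continuous_const.mul ?_)
      exact intervalIntegral.continuous_parametric_intervalIntegral_of_continuous' hIcont 0 τ₁
    have := hc.tendsto 0
    simp only [add_zero] at this
    exact this.mono_left nhdsWithin_le_nhds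
  exact le_of_tendsto_of_tendsto hL hR (eventually_nhdsWithin_of_forall fun ε hε => hreg ε hε)

/-- **Transport of ball averages along a moving ball** (continuous form of Tao's chaining
`wᵢ ≤ w_{a(i)} + Σ|w_{pᵏ(i)} − w_{pᵏ⁺¹(i)}|` with `|wᵢ − wⱼ| ≲ rᵢ^{-1/2}‖∇ω‖_{L²(10Bᵢ)}`, p. 33,
here without Poincaré's inequality): for `f ∈ C¹`, a centre `c(τ)` and radius `r(τ)` with
speed `‖c'‖ + |r'| ≤ V`, and a weight `s > 0` growing at rate `s' ≥ σ₀ > 0`, the averages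
`h(τ) = ⨍_{B̄(0,1)}‖f(c + rv)‖²`, `G(τ) = ⨍_{B̄(0,1)}‖Df(c + rv)‖²` satisfy
`s(0) h(0)^{3/2} ≤ s(τ₁) h(τ₁)^{3/2} + (9V²/4σ₀) ∫₀^{τ₁} s² h^{1/2} G`. [cite: Tao2011, §10, proof of Thm. 10.1 (p. 33, the chaining of the averages wᵢ)] -/
theorem ballAvg_transport {f : ℝ³ → F} (hf : ContDiff ℝ 1 f) {c : ℝ → ℝ³} {r s : ℝ → ℝ}
    {c' : ℝ → ℝ³} {r' s' : ℝ → ℝ} {τ₁ V σ₀ : ℝ} (hτ₁ : 0 < τ₁) (hσ₀ : 0 < σ₀)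
    (hcc : Continuous c) (hrc : Continuous r) (hsc : Continuous s)
    (hc : ∀ σ ∈ Ioo 0 τ₁, HasDerivAt c (c' σ) σ) (hr : ∀ σ ∈ Ioo 0 τ₁, HasDerivAt r (r' σ) σ)
    (hs : ∀ σ ∈ Ioo 0 τ₁, HasDerivAt s (s' σ) σ)
    (hV : ∀ σ ∈ Ioo 0 τ₁, ‖c' σ‖ + |r' σ| ≤ V) (hs' : ∀ σ ∈ Ioo 0 τ₁, σ₀ ≤ s' σ)
    (hspos : ∀ σ ∈ Ioo 0 τ₁, 0 < s σ) :
    s 0 * (ballAvg (fun x => ‖f x‖ ^ 2) (c 0) (r 0) *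
        Real.sqrt (ballAvg (fun x => ‖f x‖ ^ 2) (c 0) (r 0))) ≤
      s τ₁ * (ballAvg (fun x => ‖f x‖ ^ 2) (c τ₁) (r τ₁) *
          Real.sqrt (ballAvg (fun x => ‖f x‖ ^ 2) (c τ₁) (r τ₁))) +
        9 * V ^ 2 / (4 * σ₀) * ∫ σ in (0 : ℝ)..τ₁, s σ ^ 2 *
          (Real.sqrt (ballAvg (fun x => ‖f x‖ ^ 2) (c σ) (r σ)) *
            ballAvg (fun x => ‖fderiv ℝ f x‖ ^ 2) (c σ) (r σ)) := by
  have hfc : Continuous f := hf.continuous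
  have hDfc : Continuous (fderiv ℝ f) := hf.continuous_fderiv one_ne_zero
  set hh : ℝ → ℝ := fun σ => ballAvg (fun x => ‖f x‖ ^ 2) (c σ) (r σ) with hhh
  set GG : ℝ → ℝ := fun σ => ballAvg (fun x => ‖fderiv ℝ f x‖ ^ 2) (c σ) (r σ) with hGG
  have hτ : (Ioo 0 τ₁).Nonempty := nonempty_Ioo.2 hτ₁
  obtain ⟨σ₁, hσ₁⟩ := hτ
  have hV0 : 0 ≤ V := le_trans (by positivity) (hV σ₁ hσ₁)
  have hderiv : ∀ σ ∈ Ioo 0 τ₁, HasDerivAt hh (deriv hh σ) σ ∧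
      |deriv hh σ| ≤ 2 * V * ballAvg (fun x => ‖f x‖ * ‖fderiv ℝ f x‖) (c σ) (r σ) := by
    intro σ hσ
    obtain ⟨D, hD, hDle⟩ := hasDerivAt_ballAvg_norm_sq hf hσ hcc hrc hc hr hV
    rw [hhh, hD.deriv]
    exact ⟨hD, hDle⟩
  refine scalar_transport (h := hh) (G := GG) (h' := deriv hh) hτ₁ hσ₀ hV0
    (continuous_ballAvg_comp (hfc.norm.pow 2) hcc hrc)
    (continuous_ballAvg_comp (hDfc.norm.pow 2) hcc hrc) hsc
    (fun σ => ballAvg_nonneg (fun x => sq_nonneg _) _ _)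
    (fun σ => ballAvg_nonneg (fun x => sq_nonneg _) _ _)
    (fun σ hσ => (hderiv σ hσ).1) hs (fun σ hσ lam hlam => ?_) hs' hspos
  calc |deriv hh σ| ≤ 2 * V * ballAvg (fun x => ‖f x‖ * ‖fderiv ℝ f x‖) (c σ) (r σ) := (hderiv σ hσ).2
    _ = V * (2 * ballAvg (fun x => ‖f x‖ * ‖fderiv ℝ f x‖) (c σ) (r σ)) := by ring
    _ ≤ V * (hh σ / lam + lam * GG σ) :=
        mul_le_mul_of_nonneg_left (two_mul_ballAvg_norm_mul_le hf _ _ hlam) hV0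

end Path

/-! ## Straight paths into the annulus from the boundary layer -/

section Geometry

variable {x₀ : ℝ³} {a b k : ℝ}

/-- Derivative of the distance to `x₀` along a straight path. [folklore] -/
theorem hasDerivAt_norm_linePath (y v x₀ : ℝ³) {τ : ℝ} (h : y + τ • v - x₀ ≠ 0) :
    HasDerivAt (fun σ : ℝ => ‖y + σ • v - x₀‖)
      (⟪y + τ • v - x₀, v⟫ / ‖y + τ • v - x₀‖) τ := by
  have h1 : HasDerivAt (fun σ : ℝ => y + σ • v - x₀) v τ := by
    have := ((hasDerivAt_id τ).smul_const v).const_add y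
    simpa using this.sub_const x₀
  have h2 := h1.norm_sq
  have hpos : 0 < ‖y + τ • v - x₀‖ ^ 2 := by positivity
  have h3 := h2.sqrt hpos.ne'
  have e1 : (fun σ : ℝ => Real.sqrt (‖y + σ • v - x₀‖ ^ 2)) = fun σ => ‖y + σ • v - x₀‖ := by
    funext σ; exact Real.sqrt_sq (norm_nonneg _)
  rw [e1, Real.sqrt_sq (norm_nonneg _)] at h3
  refine h3.congr_deriv ?_
  field_simp

/-- The rate of change of the distance is at most the speed: `⟪z, v⟫/‖z‖ ≤ ‖v‖`. [folklore] -/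
theorem inner_div_norm_le_norm (z v : ℝ³) : ⟪z, v⟫ / ‖z‖ ≤ ‖v‖ := by
  rcases eq_or_ne z 0 with hz | hz
  · rw [hz, norm_zero, div_zero]; exact norm_nonneg _
  · rw [div_le_iff₀ (norm_pos_iff.2 hz), mul_comm]
    exact (le_abs_self _).trans (abs_real_inner_le_norm z v)

/-- … and at least minus the speed: `-‖v‖ ≤ ⟪z, v⟫/‖z‖`. [folklore] -/
theorem neg_norm_le_inner_div_norm (z v : ℝ³) : -‖v‖ ≤ ⟪z, v⟫ / ‖z‖ := by
  have h := inner_div_norm_le_norm z (-v)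
  rw [inner_neg_right, neg_div, norm_neg] at h
  linarith

/-- The radial unit vector has norm one. [folklore] -/
theorem norm_radialUnit {w : ℝ³} (hw : w ≠ 0) : ‖(‖w‖⁻¹) • w‖ = 1 := by
  rw [norm_smul, norm_inv, norm_norm, inv_mul_cancel₀ (norm_ne_zero_iff.2 hw)]

/-- `⟪w, ‖w‖⁻¹ w⟫ = ‖w‖`. [folklore] -/
theorem inner_radialUnit_self (w : ℝ³) : ⟪w, (‖w‖⁻¹) • w⟫ = ‖w‖ := by
  rw [real_inner_smul_right, real_inner_self_eq_norm_sq]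
  rcases eq_or_ne w 0 with hw | hw
  · rw [hw, norm_zero]; ring
  · field_simp [norm_ne_zero_iff.2 hw]

/-- A direction within `1/4` of the outward radial unit vector has a large radial component:
`⟪w, v⟫ ≥ (3/4)‖w‖`. [folklore] -/
theorem inner_ge_of_mem_ball_radialUnit {w v : ℝ³} (hv : v ∈ ball ((‖w‖⁻¹) • w) (1 / 4)) :
    3 / 4 * ‖w‖ ≤ ⟪w, v⟫ := by
  rw [mem_ball, dist_eq_norm] at hv
  have h1 : ⟪w, v⟫ = ‖w‖ + ⟪w, v - (‖w‖⁻¹) • w⟫ := by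
    rw [inner_sub_right, inner_radialUnit_self]; ring
  have h2 : |⟪w, v - (‖w‖⁻¹) • w⟫| ≤ ‖w‖ * ‖v - (‖w‖⁻¹) • w‖ := abs_real_inner_le_norm _ _
  rw [abs_le] at h2
  nlinarith [norm_nonneg w, h2.1]

/-- Such a direction has norm at most `5/4`. [folklore] -/
theorem norm_le_of_mem_ball_radialUnit {w v : ℝ³} (hw : w ≠ 0)
    (hv : v ∈ ball ((‖w‖⁻¹) • w) (1 / 4)) : ‖v‖ ≤ 5 / 4 := by
  rw [mem_ball, dist_eq_norm] at hv
  have := norm_sub_norm_le v ((‖w‖⁻¹) • w)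
  rw [norm_radialUnit hw] at this
  linarith

/-- … and at least `3/4`. [folklore] -/
theorem norm_ge_of_mem_ball_radialUnit {w v : ℝ³} (hw : w ≠ 0)
    (hv : v ∈ ball ((‖w‖⁻¹) • w) (1 / 4)) : 3 / 4 ≤ ‖v‖ := by
  rw [mem_ball, dist_eq_norm] at hv
  have := norm_sub_norm_le ((‖w‖⁻¹) • w) v
  rw [norm_radialUnit hw, norm_sub_rev] at this
  linarith

/-- Membership in the ball around the opposite unit vector, reflected. [folklore] -/
theorem neg_mem_ball_radialUnit {w v : ℝ³} (hv : v ∈ ball (-((‖w‖⁻¹) • w)) (1 / 4)) :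
    -v ∈ ball ((‖w‖⁻¹) • w) (1 / 4) := by
  rw [mem_ball, dist_eq_norm] at hv ⊢
  have e : -v - (‖w‖⁻¹) • w = -(v - -((‖w‖⁻¹) • w)) := by abel
  rw [e, norm_neg]
  exact hv

/-! ### Paths from the inner layer (moving away from `x₀`) -/

/-- **Outward paths: the distance grows at rate between `3/4` and `5/4`**, integrated form,
lower bound: `‖w + τv‖ ≥ ‖w‖ + (3/4)τ` (`τ ≥ 0`). [folklore] -/
theorem norm_add_smul_ge_inner {w v : ℝ³} (hw : w ≠ 0) (hv : v ∈ ball ((‖w‖⁻¹) • w) (1 / 4))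
    {τ : ℝ} (hτ : 0 ≤ τ) : ‖w‖ + 3 / 4 * τ ≤ ‖w + τ • v‖ := by
  have hu := norm_radialUnit hw
  have h1 : ⟪w + τ • v, (‖w‖⁻¹) • w⟫ ≤ ‖w + τ • v‖ := by
    have := abs_real_inner_le_norm (w + τ • v) ((‖w‖⁻¹) • w)
    rw [hu, mul_one] at this
    exact (le_abs_self _).trans this
  have h2 : ⟪w + τ • v, (‖w‖⁻¹) • w⟫ = ‖w‖ + τ * ⟪v, (‖w‖⁻¹) • w⟫ := by
    rw [inner_add_left, inner_radialUnit_self, real_inner_smul_left]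
  have h3 : 3 / 4 ≤ ⟪v, (‖w‖⁻¹) • w⟫ := by
    have h4 : ⟪v, (‖w‖⁻¹) • w⟫ = 1 + ⟪v - (‖w‖⁻¹) • w, (‖w‖⁻¹) • w⟫ := by
      rw [inner_sub_left, real_inner_self_eq_norm_sq, hu]; ring
    have h5 : |⟪v - (‖w‖⁻¹) • w, (‖w‖⁻¹) • w⟫| ≤ ‖v - (‖w‖⁻¹) • w‖ * 1 := by
      rw [← hu]; exact abs_real_inner_le_norm _ _
    rw [mem_ball, dist_eq_norm] at hv
    rw [abs_le] at h5
    linarith [h5.1]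
  nlinarith

/-- Upper bound: `‖w + τv‖ ≤ ‖w‖ + (5/4)τ` (`τ ≥ 0`). [folklore] -/
theorem norm_add_smul_le_inner {w v : ℝ³} (hw : w ≠ 0) (hv : v ∈ ball ((‖w‖⁻¹) • w) (1 / 4))
    {τ : ℝ} (hτ : 0 ≤ τ) : ‖w + τ • v‖ ≤ ‖w‖ + 5 / 4 * τ := by
  calc ‖w + τ • v‖ ≤ ‖w‖ + ‖τ • v‖ := norm_add_le _ _
    _ = ‖w‖ + τ * ‖v‖ := by rw [norm_smul, Real.norm_of_nonneg hτ]
    _ ≤ ‖w‖ + 5 / 4 * τ := by nlinarith [norm_le_of_mem_ball_radialUnit hw hv]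

/-- Rate bounds along an outward path (`τ ≥ 0`): `3/4 ≤ ⟪w + τv, v⟫/‖w + τv‖`. [folklore] -/
theorem rate_ge_inner {w v : ℝ³} (hw : w ≠ 0) (hv : v ∈ ball ((‖w‖⁻¹) • w) (1 / 4))
    {τ : ℝ} (hτ : 0 ≤ τ) : 3 / 4 ≤ ⟪w + τ • v, v⟫ / ‖w + τ • v‖ := by
  have hR := norm_add_smul_ge_inner hw hv hτ
  have hwpos : 0 < ‖w‖ := norm_pos_iff.2 hw
  have hRpos : 0 < ‖w + τ • v‖ := by linarith
  have hvn := norm_ge_of_mem_ball_radialUnit hw hv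
  have hup : ‖w + τ • v‖ ≤ ‖w‖ + τ * ‖v‖ := by
    calc ‖w + τ • v‖ ≤ ‖w‖ + ‖τ • v‖ := norm_add_le _ _
      _ = ‖w‖ + τ * ‖v‖ := by rw [norm_smul, Real.norm_of_nonneg hτ]
  have hnum : ⟪w + τ • v, v⟫ = ⟪w, v⟫ + τ * ‖v‖ ^ 2 := by
    rw [inner_add_left, real_inner_smul_left, real_inner_self_eq_norm_sq]
  have hin := inner_ge_of_mem_ball_radialUnit hv
  rw [le_div_iff₀ hRpos, hnum]
  nlinarith

/-! ### Paths from the outer layer (moving towards `x₀`) -/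

/-- **Inward paths: the distance decreases at rate between `1/4` and `5/4`**, integrated form:
`‖w + τv‖ ≤ ‖w‖ − τ/4` for `0 ≤ τ`, `(3/2)τ ≤ ‖w‖`, `v` within `1/4` of `−w/‖w‖`. [folklore] -/
theorem norm_add_smul_le_outer {w v : ℝ³} (hw : w ≠ 0) (hv : v ∈ ball (-((‖w‖⁻¹) • w)) (1 / 4))
    {τ : ℝ} (hτ : 0 ≤ τ) (hτw : 3 / 2 * τ ≤ ‖w‖) : ‖w + τ • v‖ ≤ ‖w‖ - τ / 4 := by
  have hv' := neg_mem_ball_radialUnit hv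
  have hin := inner_ge_of_mem_ball_radialUnit hv'
  rw [inner_neg_right] at hin
  have hvn := norm_le_of_mem_ball_radialUnit hw hv'
  rw [norm_neg] at hvn
  have h0 : 0 ≤ ‖w‖ - τ / 4 := by linarith
  refine le_of_pow_le_pow_left₀ two_ne_zero h0 ?_
  have e : ‖w + τ • v‖ ^ 2 = ‖w‖ ^ 2 + 2 * τ * ⟪w, v⟫ + τ ^ 2 * ‖v‖ ^ 2 := by
    rw [← real_inner_self_eq_norm_sq (w + τ • v), inner_add_left, inner_add_right, inner_add_right,
      real_inner_smul_left, real_inner_smul_right, real_inner_smul_left, real_inner_smul_right,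
      real_inner_self_eq_norm_sq, real_inner_self_eq_norm_sq, real_inner_comm v w]
    ring
  rw [e]
  have h1 : τ ^ 2 * ‖v‖ ^ 2 ≤ τ ^ 2 * (5 / 4) ^ 2 := by
    refine mul_le_mul_of_nonneg_left ?_ (sq_nonneg _)
    exact pow_le_pow_left₀ (norm_nonneg _) hvn 2
  nlinarith

/-- Lower bound `‖w + τv‖ ≥ ‖w‖ − (5/4)τ` (`τ ≥ 0`). [folklore] -/
theorem norm_add_smul_ge_outer {w v : ℝ³} (hw : w ≠ 0) (hv : v ∈ ball (-((‖w‖⁻¹) • w)) (1 / 4))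
    {τ : ℝ} (hτ : 0 ≤ τ) : ‖w‖ - 5 / 4 * τ ≤ ‖w + τ • v‖ := by
  have hv' := neg_mem_ball_radialUnit hv
  have hvn := norm_le_of_mem_ball_radialUnit hw hv'
  rw [norm_neg] at hvn
  have := norm_sub_norm_le w (-(τ • v))
  rw [sub_neg_eq_add, norm_neg, norm_smul, Real.norm_of_nonneg hτ] at this
  nlinarith

/-- Rate bound along an inward path: `1/4 ≤ −⟪w + τv, v⟫/‖w + τv‖` for `0 ≤ τ ≤ (4/15)‖w‖`. [folklore] -/
theorem rate_ge_outer {w v : ℝ³} (hw : w ≠ 0) (hv : v ∈ ball (-((‖w‖⁻¹) • w)) (1 / 4))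
    {τ : ℝ} (hτ : 0 ≤ τ) (hτw : 15 / 4 * τ ≤ ‖w‖) :
    1 / 4 ≤ -(⟪w + τ • v, v⟫ / ‖w + τ • v‖) := by
  have hv' := neg_mem_ball_radialUnit hv
  have hin := inner_ge_of_mem_ball_radialUnit hv'
  rw [inner_neg_right] at hin
  have hvn := norm_le_of_mem_ball_radialUnit hw hv'
  rw [norm_neg] at hvn
  have hup : ‖w + τ • v‖ ≤ ‖w‖ - τ / 4 := norm_add_smul_le_outer hw hv hτ (by linarith)
  have hlo : ‖w‖ - 5 / 4 * τ ≤ ‖w + τ • v‖ := norm_add_smul_ge_outer hw hv hτ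
  have hwpos : 0 < ‖w‖ := norm_pos_iff.2 hw
  have hRpos : 0 < ‖w + τ • v‖ := by linarith
  have hnum : ⟪w + τ • v, v⟫ = ⟪w, v⟫ + τ * ‖v‖ ^ 2 := by
    rw [inner_add_left, real_inner_smul_left, real_inner_self_eq_norm_sq]
  rw [← neg_div, le_div_iff₀ hRpos, hnum]
  have h1 : τ * ‖v‖ ^ 2 ≤ τ * (5 / 4) ^ 2 :=
    mul_le_mul_of_nonneg_left (pow_le_pow_left₀ (norm_nonneg _) hvn 2) hτ
  nlinarith

/-! ### The depth along the paths -/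

/-- **Good paths.** The data the transport lemma needs along the straight path `τ ↦ y + τv`,
`0 ≤ τ ≤ k⁻¹/2`: a globally continuous weight `s` which on `[0, k⁻¹/2]` is the depth of the
moving point (and `100 ×` its Whitney radius), grows at a rate in `[1/4, 5/4]`, and stays within
`[d(y) + τ/4, d(y) + 5τ/4]`; and `‖v‖ ≤ 5/4`. [folklore] -/
def GoodPath (x₀ : ℝ³) (a b k : ℝ) (y v : ℝ³) : Prop :=
  ‖v‖ ≤ 5 / 4 ∧ ∃ s s' : ℝ → ℝ, Continuous s ∧
    (∀ τ ∈ Icc (0 : ℝ) (k⁻¹ / 2), s τ = annDepth x₀ a b (y + τ • v) ∧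
      whitneyRadius x₀ a b k (y + τ • v) = s τ / 100 ∧
      annDepth x₀ a b y + τ / 4 ≤ s τ ∧ s τ ≤ annDepth x₀ a b y + 5 / 4 * τ) ∧
    (∀ τ ∈ Ioo (0 : ℝ) (k⁻¹ / 2), HasDerivAt s (s' τ) τ ∧ 1 / 4 ≤ s' τ ∧ s' τ ≤ 5 / 4)

/-- **Paths from the inner layer are good**: `a < ‖y − x₀‖ < a + k⁻¹/8`, `v` within `1/4` of
the outward unit vector, under `0 < a`, `a + 2k⁻¹ < b`. [folklore] -/
theorem goodPath_inner (hk : 0 < k) (ha : 0 < a) (hab : a + 2 * k⁻¹ < b) {y v : ℝ³}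
    (hy1 : a < ‖y - x₀‖) (hy2 : ‖y - x₀‖ < a + k⁻¹ / 8)
    (hv : v ∈ ball ((‖y - x₀‖⁻¹) • (y - x₀)) (1 / 4)) : GoodPath x₀ a b k y v := by
  have hw : y - x₀ ≠ 0 := by
    intro h; rw [h, norm_zero] at hy1; linarith
  have hℓ : 0 < k⁻¹ := inv_pos.2 hk
  have hdy : annDepth x₀ a b y = ‖y - x₀‖ - a := annDepth_eq_inner (by linarith)
  have ez : ∀ τ : ℝ, y + τ • v - x₀ = (y - x₀) + τ • v := fun τ => by abel
  refine ⟨norm_le_of_mem_ball_radialUnit hw hv, fun τ => ‖y + τ • v - x₀‖ - a,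
    fun τ => ⟪y + τ • v - x₀, v⟫ / ‖y + τ • v - x₀‖, by fun_prop, fun τ hτ => ?_, fun τ hτ => ?_⟩
  · have hlo := norm_add_smul_ge_inner hw hv hτ.1
    have hhi := norm_add_smul_le_inner hw hv hτ.1
    rw [← ez] at hlo hhi
    have hd : annDepth x₀ a b (y + τ • v) = ‖y + τ • v - x₀‖ - a :=
      annDepth_eq_inner (by linarith [hτ.2])
    refine ⟨hd.symm, ?_, ?_, ?_⟩
    · rw [whitneyRadius_eq_of_le (by rw [hd]; linarith) (by rw [hd]; linarith [hτ.2]), hd]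
    · rw [hdy]; linarith
    · rw [hdy]; linarith
  · have hlo := norm_add_smul_ge_inner hw hv hτ.1.le
    rw [← ez] at hlo
    have hne : y + τ • v - x₀ ≠ 0 := by
      intro h; rw [h, norm_zero] at hlo; linarith [norm_nonneg (y - x₀), hτ.1]
    refine ⟨(hasDerivAt_norm_linePath y v x₀ hne).sub_const a, ?_, ?_⟩
    · have := rate_ge_inner hw hv hτ.1.le
      rw [← ez] at this; linarith
    · exact (inner_div_norm_le_norm _ _).trans (norm_le_of_mem_ball_radialUnit hw hv)

/-- **Paths from the outer layer are good**: `b − k⁻¹/8 < ‖y − x₀‖ < b`, `v` within `1/4` of the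
inward unit vector, under `0 < a`, `a + 2k⁻¹ < b`. [folklore] -/
theorem goodPath_outer (hk : 0 < k) (ha : 0 < a) (hab : a + 2 * k⁻¹ < b) {y v : ℝ³}
    (hy1 : b - k⁻¹ / 8 < ‖y - x₀‖) (hy2 : ‖y - x₀‖ < b)
    (hv : v ∈ ball (-((‖y - x₀‖⁻¹) • (y - x₀))) (1 / 4)) : GoodPath x₀ a b k y v := by
  have hℓ : 0 < k⁻¹ := inv_pos.2 hk
  have hw : y - x₀ ≠ 0 := by
    intro h; rw [h, norm_zero] at hy1; linarith
  have hdy : annDepth x₀ a b y = b - ‖y - x₀‖ := annDepth_eq_outer (by linarith)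
  have ez : ∀ τ : ℝ, y + τ • v - x₀ = (y - x₀) + τ • v := fun τ => by abel
  have hv' := neg_mem_ball_radialUnit hv
  have hvn : ‖v‖ ≤ 5 / 4 := by
    have := norm_le_of_mem_ball_radialUnit hw hv'; rwa [norm_neg] at this
  refine ⟨hvn, fun τ => b - ‖y + τ • v - x₀‖,
    fun τ => -(⟪y + τ • v - x₀, v⟫ / ‖y + τ • v - x₀‖), by fun_prop, fun τ hτ => ?_, fun τ hτ => ?_⟩
  · have hlo := norm_add_smul_ge_outer hw hv hτ.1
    have hhi := norm_add_smul_le_outer hw hv hτ.1 (by linarith [hτ.2])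
    rw [← ez] at hlo hhi
    have hd : annDepth x₀ a b (y + τ • v) = b - ‖y + τ • v - x₀‖ :=
      annDepth_eq_outer (by linarith [hτ.2])
    refine ⟨hd.symm, ?_, ?_, ?_⟩
    · rw [whitneyRadius_eq_of_le (by rw [hd]; linarith) (by rw [hd]; linarith [hτ.2]), hd]
    · rw [hdy]; linarith
    · rw [hdy]; linarith [hτ.2]
  · have hlo := norm_add_smul_ge_outer hw hv hτ.1.le
    rw [← ez] at hlo
    have hne : y + τ • v - x₀ ≠ 0 := by
      intro h; rw [h, norm_zero] at hlo; linarith [hτ.2, hτ.1]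
    refine ⟨(hasDerivAt_norm_linePath y v x₀ hne).const_sub b, ?_, ?_⟩
    · have := rate_ge_outer hw hv hτ.1.le (by linarith [hτ.2])
      rw [← ez] at this; exact this
    · have := neg_norm_le_inner_div_norm (y + τ • v - x₀) v
      linarith

/-- The **inward direction field** of the annulus: the outward radial unit vector on the inner
half, the inward one on the outer half. [folklore] -/
def inwardDir (x₀ : ℝ³) (a b : ℝ) (y : ℝ³) : ℝ³ :=
  if ‖y - x₀‖ < (a + b) / 2 then (‖y - x₀‖⁻¹) • (y - x₀) else -((‖y - x₀‖⁻¹) • (y - x₀))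

/-- The inward direction field is measurable. [folklore] -/
theorem measurable_inwardDir (x₀ : ℝ³) (a b : ℝ) : Measurable (inwardDir x₀ a b) := by
  have h1 : Measurable fun y : ℝ³ => (‖y - x₀‖⁻¹) • (y - x₀) :=
    ((continuous_id.sub continuous_const).norm.measurable.inv).smul
      (continuous_id.sub continuous_const).measurable
  refine Measurable.ite ?_ h1 h1.neg
  exact measurableSet_lt (continuous_id.sub continuous_const).norm.measurable measurable_const

/-- The inward direction is a unit vector off the centre. [folklore] -/
theorem norm_inwardDir {y : ℝ³} (hy : y ≠ x₀) : ‖inwardDir x₀ a b y‖ = 1 := by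
  have hw : y - x₀ ≠ 0 := sub_ne_zero.2 hy
  unfold inwardDir
  split_ifs
  · exact norm_radialUnit hw
  · rw [norm_neg]; exact norm_radialUnit hw

/-- **Every point of the boundary layer `0 < d < k⁻¹/8` starts good paths** in all directions
within `1/4` of the inward direction (`0 < k`, `0 < a`, `a + 2k⁻¹ < b`). [folklore] -/
theorem goodPath_of_mem_layer (hk : 0 < k) (ha : 0 < a) (hab : a + 2 * k⁻¹ < b) {y v : ℝ³}
    (hy0 : 0 < annDepth x₀ a b y) (hy1 : annDepth x₀ a b y < k⁻¹ / 8)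
    (hv : v ∈ ball (inwardDir x₀ a b y) (1 / 4)) : GoodPath x₀ a b k y v := by
  have hℓ : 0 < k⁻¹ := inv_pos.2 hk
  rw [annDepth_pos_iff] at hy0
  unfold inwardDir at hv
  split_ifs at hv with h
  · refine goodPath_inner hk ha hab hy0.1 ?_ hv
    rw [annDepth_def] at hy1
    have : min (‖y - x₀‖ - a) (b - ‖y - x₀‖) = ‖y - x₀‖ - a := min_eq_left (by linarith)
    rw [this] at hy1; linarith
  · refine goodPath_outer hk ha hab ?_ hy0.2 hv
    have h' := not_lt.1 h
    rw [annDepth_def] at hy1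
    have : min (‖y - x₀‖ - a) (b - ‖y - x₀‖) = b - ‖y - x₀‖ := min_eq_right (by linarith)
    rw [this] at hy1; linarith

end Geometry

/-! ## The Whitney averages and their transport along good paths -/

section WhitneyAvg

variable {F : Type*} [NormedAddCommGroup F] [InnerProductSpace ℝ F]
variable {x₀ : ℝ³} {a b k M : ℝ}

/-- The **Whitney average** of `g` at `z`: the average of `g` over the ball `B(z, Mρ(z))` of `M`
times the Whitney radius (written on the unit ball, so `= g(z)` off the annulus). For
`g = |ω|²` and `M = 3` this is Tao's `wᵢ² = |3Bᵢ|⁻¹∫_{3Bᵢ}|ω|²`. [cite: Tao2011, §10, proof of Thm. 10.1 (the averages wᵢ, p. 33)] -/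
def whitneyAvg (x₀ : ℝ³) (a b k M : ℝ) (g : ℝ³ → ℝ) (z : ℝ³) : ℝ :=
  ballAvg g z (M * whitneyRadius x₀ a b k z)

/-- Unfolding the Whitney average. [folklore] -/
theorem whitneyAvg_def (g : ℝ³ → ℝ) (z : ℝ³) :
    whitneyAvg x₀ a b k M g z = ballAvg g z (M * whitneyRadius x₀ a b k z) := rfl

/-- Whitney averages of nonnegative functions are nonnegative. [folklore] -/
theorem whitneyAvg_nonneg {g : ℝ³ → ℝ} (hg : ∀ x, 0 ≤ g x) (z : ℝ³) :
    0 ≤ whitneyAvg x₀ a b k M g z :=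
  ballAvg_nonneg hg _ _

/-- The Whitney average of a continuous function is continuous. [folklore] -/
theorem continuous_whitneyAvg {g : ℝ³ → ℝ} (hg : Continuous g) :
    Continuous (whitneyAvg x₀ a b k M g) :=
  continuous_ballAvg_comp hg continuous_id (continuous_const.mul (continuous_whitneyRadius x₀ a b k))

/-- **The Whitney average as a ball average** on the open annulus (`M > 0`, `k > 0`):
`whitneyAvg g z = ((Mρ(z))³ vol B̄(0,1))⁻¹ ∫_{B(z, Mρ(z))} g`. [folklore] -/
theorem whitneyAvg_eq (hk : 0 < k) (hM : 0 < M) (g : ℝ³ → ℝ) {z : ℝ³} (hz : 0 < annDepth x₀ a b z) :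
    whitneyAvg x₀ a b k M g z = ((M * whitneyRadius x₀ a b k z) ^ 3 * unitBallVol)⁻¹ *
      ∫ x in ball z (M * whitneyRadius x₀ a b k z), g x :=
  ballAvg_eq_of_pos' g z (mul_pos hM (whitneyRadius_pos hk hz))

/-- **The sup bound for the Whitney averages** (Tao's (10.23),
"`wᵢ ≲ c^{0.05}δ^{-1}W^{1/2}rᵢ^{-2}`"): for a continuous `g ≥ 0`, `0 < M ≤ 50`, and a centre `z`
of the open annulus, `whitneyAvg g z ≤ (∫ g η) / (50 vol B̄(0,1) M³ k ρ(z)⁴)`. [cite: Tao2011, §10, proof of Thm. 10.1 ((10.22)–(10.23))] -/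
theorem whitneyAvg_le (hk : 0 < k) (hM : 0 < M) (hM' : M ≤ 50) {g : ℝ³ → ℝ} (hg : Continuous g)
    (hg0 : ∀ x, 0 ≤ g x) {z : ℝ³} (hz : 0 < annDepth x₀ a b z) :
    whitneyAvg x₀ a b k M g z ≤ (∫ x, g x * annularRamp k a b ‖x - x₀‖) /
      (50 * unitBallVol * M ^ 3 * k * whitneyRadius x₀ a b k z ^ 4) := by
  set ρ := whitneyRadius x₀ a b k z with hρ
  have hρ0 : 0 < ρ := whitneyRadius_pos hk hz
  have hκ := unitBallVol_pos
  have hloc := mul_setIntegral_whitneyBall_le (x₀ := x₀) (a := a) (b := b) (k := k) hk M z hg hg0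
  rw [annularRamp_eq_mul_whitneyRadius hk hz.le, ← hρ] at hloc
  have hc : (1:ℝ) / 2 ≤ 1 - M / 100 := by linarith
  rw [whitneyAvg_eq hk hM g hz, ← hρ, le_div_iff₀ (by positivity)]
  have hI0 : 0 ≤ ∫ x in ball z (M * ρ), g x := setIntegral_nonneg measurableSet_ball fun x _ => hg0 x
  calc ((M * ρ) ^ 3 * unitBallVol)⁻¹ * (∫ x in ball z (M * ρ), g x) *
        (50 * unitBallVol * M ^ 3 * k * ρ ^ 4)
      = 50 * k * ρ * ∫ x in ball z (M * ρ), g x := by field_simp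
    _ ≤ (1 - M / 100) * (100 * k * ρ) * ∫ x in ball z (M * ρ), g x := by
        refine mul_le_mul_of_nonneg_right ?_ hI0
        nlinarith [mul_pos hk hρ0]
    _ ≤ ∫ x, g x * annularRamp k a b ‖x - x₀‖ := hloc

/-- The straight path has velocity `v`. [folklore] -/
theorem hasDerivAt_linePath (y v : ℝ³) (σ : ℝ) : HasDerivAt (fun τ : ℝ => y + τ • v) v σ := by
  have := ((hasDerivAt_id σ).smul_const v).const_add y
  simpa using this

/-- **Transport of the Whitney averages along a good path** (the path lemma specialised to
`c(τ) = y + τv`, `r = Mρ`, weight `s = d`, `V = (5/4)(1 + M/100)`, `σ₀ = 1/4`): for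
`0 < τ₁ ≤ k⁻¹/2`, writing `A = whitneyAvg ‖f‖²`, `G = whitneyAvg ‖Df‖²`, `d = annDepth`,
`d(y) A(y)^{3/2} ≤ d(z_{τ₁}) A(z_{τ₁})^{3/2} + 9V² ∫₀^{τ₁} d(z_σ)² A(z_σ)^{1/2} G(z_σ) dσ`,
`z_σ = y + σv`. [cite: Tao2011, §10, proof of Thm. 10.1 (p. 33, chaining of the wᵢ)] -/
theorem transport_of_goodPath {f : ℝ³ → F} (hf : ContDiff ℝ 1 f) (hM : 0 ≤ M) {y v : ℝ³}
    (hy : 0 < annDepth x₀ a b y) (hP : GoodPath x₀ a b k y v) {τ₁ : ℝ} (hτ₁ : 0 < τ₁)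
    (hτ₁' : τ₁ ≤ k⁻¹ / 2) :
    annDepth x₀ a b y * (whitneyAvg x₀ a b k M (fun x => ‖f x‖ ^ 2) y *
        Real.sqrt (whitneyAvg x₀ a b k M (fun x => ‖f x‖ ^ 2) y)) ≤
      annDepth x₀ a b (y + τ₁ • v) * (whitneyAvg x₀ a b k M (fun x => ‖f x‖ ^ 2) (y + τ₁ • v) *
          Real.sqrt (whitneyAvg x₀ a b k M (fun x => ‖f x‖ ^ 2) (y + τ₁ • v))) +
        9 * (5 / 4 * (1 + M / 100)) ^ 2 * ∫ σ in (0 : ℝ)..τ₁, annDepth x₀ a b (y + σ • v) ^ 2 *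
          (Real.sqrt (whitneyAvg x₀ a b k M (fun x => ‖f x‖ ^ 2) (y + σ • v)) *
            whitneyAvg x₀ a b k M (fun x => ‖fderiv ℝ f x‖ ^ 2) (y + σ • v)) := by
  obtain ⟨hvn, s, s', hsc, h1, h2⟩ := hP
  have hIoo : ∀ σ ∈ Ioo 0 τ₁, σ ∈ Ioo 0 (k⁻¹ / 2) := fun σ hσ => ⟨hσ.1, hσ.2.trans_le hτ₁'⟩
  have hIcc : ∀ σ ∈ Icc 0 τ₁, σ ∈ Icc 0 (k⁻¹ / 2) := fun σ hσ => ⟨hσ.1, hσ.2.trans hτ₁'⟩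
  have key := ballAvg_transport (F := F) hf (c := fun τ => y + τ • v)
    (r := fun τ => M * whitneyRadius x₀ a b k (y + τ • v)) (s := s) (c' := fun _ => v)
    (r' := fun τ => M * (s' τ / 100)) (s' := s') (V := 5 / 4 * (1 + M / 100)) (σ₀ := 1 / 4)
    hτ₁ (by norm_num) (by fun_prop)
    (continuous_const.mul ((continuous_whitneyRadius x₀ a b k).comp (by fun_prop))) hsc
    (fun σ _ => hasDerivAt_linePath y v σ)
    (fun σ hσ => by
      have hσ' := hIoo σ hσ
      have hder : HasDerivAt (fun τ => M * (s τ / 100)) (M * (s' σ / 100)) σ :=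
        ((h2 σ hσ').1.div_const 100).const_mul M
      refine hder.congr_of_eventuallyEq ?_
      filter_upwards [Ioo_mem_nhds hσ'.1 hσ'.2] with τ hτ
      rw [(h1 τ (Ioo_subset_Icc_self hτ)).2.1])
    (fun σ hσ => (h2 σ (hIoo σ hσ)).1)
    (fun σ hσ => by
      have h := h2 σ (hIoo σ hσ)
      rw [abs_of_nonneg (by nlinarith [h.2.1]), show ‖(fun _ : ℝ => v) σ‖ = ‖v‖ from rfl]
      nlinarith [h.2.2])
    (fun σ hσ => (h2 σ (hIoo σ hσ)).2.1)
    (fun σ hσ => by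
      have h := (h1 σ (Ioo_subset_Icc_self (hIoo σ hσ))).2.2.1
      linarith [hσ.1])
  have hs0 : s 0 = annDepth x₀ a b y := by
    have := (h1 0 ⟨le_rfl, hτ₁.le.trans hτ₁'⟩).1
    simpa using this
  have hs1 : s τ₁ = annDepth x₀ a b (y + τ₁ • v) := (h1 τ₁ (hIcc τ₁ ⟨hτ₁.le, le_rfl⟩)).1
  have hC : 9 * (5 / 4 * (1 + M / 100)) ^ 2 / (4 * (1 / 4)) = 9 * (5 / 4 * (1 + M / 100)) ^ 2 := by
    norm_num
  rw [hs0, hs1, hC] at key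
  simp only [zero_smul, add_zero] at key
  refine key.trans (le_of_eq ?_)
  congr 1
  congr 1
  refine intervalIntegral.integral_congr fun σ hσ => ?_
  rw [uIcc_of_le hτ₁.le] at hσ
  simp only [whitneyAvg_def]
  rw [(h1 σ (hIcc σ hσ)).1]

end WhitneyAvg

/-! ## Averaging over endpoints and directions; the `ℝ≥0∞` form -/

section Averaging

variable {F : Type*} [NormedAddCommGroup F] [InnerProductSpace ℝ F]
variable {x₀ : ℝ³} {a b k M : ℝ}

/-- The first transported density `Φ₁ = d · A^{3/2}` (`A = whitneyAvg ‖f‖²`). [folklore] -/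
def chainPhi₁ (x₀ : ℝ³) (a b k M : ℝ) (f : ℝ³ → F) (z : ℝ³) : ℝ :=
  annDepth x₀ a b z * (whitneyAvg x₀ a b k M (fun x => ‖f x‖ ^ 2) z *
    Real.sqrt (whitneyAvg x₀ a b k M (fun x => ‖f x‖ ^ 2) z))

/-- The second transported density `Φ₂ = d² · A^{1/2} · G` (`G = whitneyAvg ‖Df‖²`). [folklore] -/
def chainPhi₂ (x₀ : ℝ³) (a b k M : ℝ) (f : ℝ³ → F) (z : ℝ³) : ℝ :=
  annDepth x₀ a b z ^ 2 * (Real.sqrt (whitneyAvg x₀ a b k M (fun x => ‖f x‖ ^ 2) z) *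
    whitneyAvg x₀ a b k M (fun x => ‖fderiv ℝ f x‖ ^ 2) z)

omit [InnerProductSpace ℝ F] in
/-- Unfolding `chainPhi₁`. [folklore] -/
theorem chainPhi₁_def (f : ℝ³ → F) (z : ℝ³) : chainPhi₁ x₀ a b k M f z =
    annDepth x₀ a b z * (whitneyAvg x₀ a b k M (fun x => ‖f x‖ ^ 2) z *
      Real.sqrt (whitneyAvg x₀ a b k M (fun x => ‖f x‖ ^ 2) z)) := rfl

/-- Unfolding `chainPhi₂`. [folklore] -/
theorem chainPhi₂_def (f : ℝ³ → F) (z : ℝ³) : chainPhi₂ x₀ a b k M f z =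
    annDepth x₀ a b z ^ 2 * (Real.sqrt (whitneyAvg x₀ a b k M (fun x => ‖f x‖ ^ 2) z) *
      whitneyAvg x₀ a b k M (fun x => ‖fderiv ℝ f x‖ ^ 2) z) := rfl

/-- `Φ₁` is continuous for `f ∈ C¹`. [folklore] -/
theorem continuous_chainPhi₁ {f : ℝ³ → F} (hf : ContDiff ℝ 1 f) :
    Continuous (chainPhi₁ x₀ a b k M f) := by
  have hA : Continuous (whitneyAvg x₀ a b k M (fun x => ‖f x‖ ^ 2)) :=
    continuous_whitneyAvg (hf.continuous.norm.pow 2)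
  unfold chainPhi₁
  exact (continuous_annDepth x₀ a b).mul (hA.mul hA.sqrt)

/-- `Φ₂` is continuous for `f ∈ C¹`. [folklore] -/
theorem continuous_chainPhi₂ {f : ℝ³ → F} (hf : ContDiff ℝ 1 f) :
    Continuous (chainPhi₂ x₀ a b k M f) := by
  have hA : Continuous (whitneyAvg x₀ a b k M (fun x => ‖f x‖ ^ 2)) :=
    continuous_whitneyAvg (hf.continuous.norm.pow 2)
  have hG : Continuous (whitneyAvg x₀ a b k M (fun x => ‖fderiv ℝ f x‖ ^ 2)) :=
    continuous_whitneyAvg ((hf.continuous_fderiv one_ne_zero).norm.pow 2)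
  unfold chainPhi₂
  exact ((continuous_annDepth x₀ a b).pow 2).mul (hA.sqrt.mul hG)

/-- `Φ₂ ≥ 0` everywhere. [folklore] -/
theorem chainPhi₂_nonneg (f : ℝ³ → F) (z : ℝ³) : 0 ≤ chainPhi₂ x₀ a b k M f z :=
  mul_nonneg (sq_nonneg _) (mul_nonneg (Real.sqrt_nonneg _)
    (whitneyAvg_nonneg (fun _ => sq_nonneg _) _))

omit [InnerProductSpace ℝ F] in
/-- `Φ₁ ≥ 0` on the closed annulus. [folklore] -/
theorem chainPhi₁_nonneg (f : ℝ³ → F) {z : ℝ³} (hz : 0 ≤ annDepth x₀ a b z) :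
    0 ≤ chainPhi₁ x₀ a b k M f z :=
  mul_nonneg hz (mul_nonneg (whitneyAvg_nonneg (fun _ => sq_nonneg _) _) (Real.sqrt_nonneg _))

/-- **The averaged transport inequality, `ℝ≥0∞` form.** For a point `y` of the boundary layer
`0 < d < k⁻¹/8` and a direction `v` within `1/4` of the inward direction, averaging the transport
inequality over the endpoints `τ₁ ∈ [k⁻¹/4, k⁻¹/2]`:
`(k⁻¹/4) Φ₁(y) ≤ ∫_{k⁻¹/4}^{k⁻¹/2} Φ₁(y + τv) dτ + (k⁻¹/4)·9V²·∫₀^{k⁻¹/2} Φ₂(y + τv) dτ`. [cite: Tao2011, §10, proof of Thm. 10.1 (p. 33, chaining of the wᵢ)] -/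
theorem lintegral_transport_of_mem_layer {f : ℝ³ → F} (hf : ContDiff ℝ 1 f) (hk : 0 < k)
    (ha : 0 < a) (hab : a + 2 * k⁻¹ < b) (hM : 0 ≤ M) {y v : ℝ³}
    (hy0 : 0 < annDepth x₀ a b y) (hy1 : annDepth x₀ a b y < k⁻¹ / 8)
    (hv : v ∈ ball (inwardDir x₀ a b y) (1 / 4)) :
    ENNReal.ofReal (k⁻¹ / 4 * chainPhi₁ x₀ a b k M f y) ≤
      (∫⁻ τ in Ioc (k⁻¹ / 4) (k⁻¹ / 2), ENNReal.ofReal (chainPhi₁ x₀ a b k M f (y + τ • v))) +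
        ENNReal.ofReal (k⁻¹ / 4 * (9 * (5 / 4 * (1 + M / 100)) ^ 2)) *
          ∫⁻ τ in Ioc 0 (k⁻¹ / 2), ENNReal.ofReal (chainPhi₂ x₀ a b k M f (y + τ • v)) := by
  have hℓ : 0 < k⁻¹ := inv_pos.2 hk
  have hP := goodPath_of_mem_layer hk ha hab hy0 hy1 hv
  set C : ℝ := 9 * (5 / 4 * (1 + M / 100)) ^ 2 with hC
  have hC0 : 0 ≤ C := by rw [hC]; positivity
  set φ₁ : ℝ → ℝ := fun τ => chainPhi₁ x₀ a b k M f (y + τ • v) with hφ₁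
  set φ₂ : ℝ → ℝ := fun τ => chainPhi₂ x₀ a b k M f (y + τ • v) with hφ₂
  have hφ₁c : Continuous φ₁ := (continuous_chainPhi₁ hf).comp (by fun_prop)
  have hφ₂c : Continuous φ₂ := (continuous_chainPhi₂ hf).comp (by fun_prop)
  have hφ₂0 : ∀ τ, 0 ≤ φ₂ τ := fun τ => chainPhi₂_nonneg f _
  have hdepth : ∀ τ ∈ Icc (0 : ℝ) (k⁻¹ / 2), 0 ≤ annDepth x₀ a b (y + τ • v) := by
    intro τ hτ
    obtain ⟨_, s, s', _, h1, _⟩ := hP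
    have h := h1 τ hτ
    rw [← h.1]; linarith [h.2.2.1, hτ.1]
  have hφ₁0 : ∀ τ ∈ Icc (0 : ℝ) (k⁻¹ / 2), 0 ≤ φ₁ τ := fun τ hτ => chainPhi₁_nonneg f (hdepth τ hτ)
  set J : ℝ := ∫ σ in (0 : ℝ)..(k⁻¹ / 2), φ₂ σ with hJ
  -- pointwise in the endpoint
  have hpt : ∀ τ₁ ∈ Icc (k⁻¹ / 4) (k⁻¹ / 2), chainPhi₁ x₀ a b k M f y ≤ φ₁ τ₁ + C * J := by
    intro τ₁ hτ₁
    have hτ₁0 : 0 < τ₁ := by linarith [hτ₁.1]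
    have ht := transport_of_goodPath (x₀ := x₀) (a := a) (b := b) (k := k) (M := M) hf hM hy0 hP
      hτ₁0 hτ₁.2
    have hmono : ∫ σ in (0 : ℝ)..τ₁, φ₂ σ ≤ J :=
      intervalIntegral.integral_mono_interval le_rfl hτ₁0.le hτ₁.2
        (Eventually.of_forall fun σ => hφ₂0 σ) (hφ₂c.intervalIntegrable _ _)
    rw [chainPhi₁_def]
    refine ht.trans ?_
    show _ ≤ chainPhi₁ x₀ a b k M f (y + τ₁ • v) + C * J
    rw [chainPhi₁_def]
    exact add_le_add le_rfl (mul_le_mul_of_nonneg_left hmono hC0)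
  -- integrate over the endpoint
  have hint : (k⁻¹ / 2 - k⁻¹ / 4) * chainPhi₁ x₀ a b k M f y ≤
      (∫ τ in (k⁻¹ / 4)..(k⁻¹ / 2), φ₁ τ) + (k⁻¹ / 2 - k⁻¹ / 4) * (C * J) := by
    have h1 : ∫ _ in (k⁻¹ / 4)..(k⁻¹ / 2), chainPhi₁ x₀ a b k M f y =
        (k⁻¹ / 2 - k⁻¹ / 4) * chainPhi₁ x₀ a b k M f y := by
      rw [intervalIntegral.integral_const, smul_eq_mul]
    have h2 : ∫ τ in (k⁻¹ / 4)..(k⁻¹ / 2), (φ₁ τ + C * J) =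
        (∫ τ in (k⁻¹ / 4)..(k⁻¹ / 2), φ₁ τ) + (k⁻¹ / 2 - k⁻¹ / 4) * (C * J) := by
      rw [intervalIntegral.integral_add (hφ₁c.intervalIntegrable _ _) intervalIntegrable_const,
        intervalIntegral.integral_const, smul_eq_mul]
    rw [← h1, ← h2]
    exact intervalIntegral.integral_mono_on (by linarith) intervalIntegrable_const
      ((hφ₁c.intervalIntegrable _ _).add intervalIntegrable_const) hpt
  have e14 : k⁻¹ / 2 - k⁻¹ / 4 = k⁻¹ / 4 := by ring
  rw [e14] at hint
  -- pass to `ℝ≥0∞`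
  have hI1 : 0 ≤ ∫ τ in (k⁻¹ / 4)..(k⁻¹ / 2), φ₁ τ :=
    intervalIntegral.integral_nonneg (by linarith) fun τ hτ => hφ₁0 τ ⟨by linarith [hτ.1], hτ.2⟩
  have hJ0 : 0 ≤ J := intervalIntegral.integral_nonneg (by linarith) fun τ _ => hφ₂0 τ
  have hconv1 : ENNReal.ofReal (∫ τ in (k⁻¹ / 4)..(k⁻¹ / 2), φ₁ τ) =
      ∫⁻ τ in Ioc (k⁻¹ / 4) (k⁻¹ / 2), ENNReal.ofReal (φ₁ τ) := by
    rw [intervalIntegral.integral_of_le (by linarith), ofReal_integral_eq_lintegral_ofReal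
      (hφ₁c.integrableOn_Icc.mono_set Ioc_subset_Icc_self)]
    rw [Filter.EventuallyLE, ae_restrict_iff' measurableSet_Ioc]
    exact Eventually.of_forall fun τ hτ => hφ₁0 τ ⟨by linarith [hτ.1], hτ.2⟩
  have hconv2 : ENNReal.ofReal J = ∫⁻ τ in Ioc 0 (k⁻¹ / 2), ENNReal.ofReal (φ₂ τ) := by
    rw [hJ, intervalIntegral.integral_of_le (by linarith), ofReal_integral_eq_lintegral_ofReal
      (hφ₂c.integrableOn_Icc.mono_set Ioc_subset_Icc_self)
      (Eventually.of_forall fun τ => hφ₂0 τ)]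
  calc ENNReal.ofReal (k⁻¹ / 4 * chainPhi₁ x₀ a b k M f y)
      ≤ ENNReal.ofReal ((∫ τ in (k⁻¹ / 4)..(k⁻¹ / 2), φ₁ τ) + k⁻¹ / 4 * (C * J)) :=
        ENNReal.ofReal_le_ofReal hint
    _ = ENNReal.ofReal (∫ τ in (k⁻¹ / 4)..(k⁻¹ / 2), φ₁ τ) +
          ENNReal.ofReal (k⁻¹ / 4 * C) * ENNReal.ofReal J := by
        rw [ENNReal.ofReal_add hI1 (by positivity), ← ENNReal.ofReal_mul (by positivity),
          mul_assoc (k⁻¹ / 4) C J]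
    _ = _ := by rw [hconv1, hconv2]

end Averaging

/-! ## Overlap bounds for the Whitney averages -/

section Overlap

variable {x₀ : ℝ³} {a b k M : ℝ}

/-- **The Whitney average as a kernel integral** (`ℝ≥0∞` form, continuous `g ≥ 0`, centre in
the open annulus): `A(z) = (M³ vol B̄(0,1))⁻¹ ∫ ρ(z)⁻³ 1[x ∈ B(z, Mρ(z))] g(x) dx`. [folklore] -/
theorem ofReal_whitneyAvg_eq (hk : 0 < k) (hM : 0 < M) {g : ℝ³ → ℝ} (hg : Continuous g)
    (hg0 : ∀ x, 0 ≤ g x) {z : ℝ³} (hz : 0 < annDepth x₀ a b z) :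
    ENNReal.ofReal (whitneyAvg x₀ a b k M g z) = ENNReal.ofReal ((M ^ 3 * unitBallVol)⁻¹) *
      ∫⁻ x, whitneyKernel x₀ a b k M 3 z x * ENNReal.ofReal (g x) := by
  rw [whitneyAvg_eq hk hM g hz, lintegral_whitneyKernel_mul]
  set ρ := whitneyRadius x₀ a b k z with hρ
  have hρ0 : 0 < ρ := whitneyRadius_pos hk hz
  have hκ := unitBallVol_pos
  have hint : IntegrableOn g (ball z (M * ρ)) :=
    (hg.continuousOn.integrableOn_compact (isCompact_closedBall z _)).mono_set ball_subset_closedBall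
  rw [← ofReal_integral_eq_lintegral_ofReal hint (Eventually.of_forall fun x => hg0 x),
    ← ENNReal.ofReal_mul (by positivity), ← ENNReal.ofReal_mul (by positivity)]
  congr 1
  rw [mul_pow, inv_pow]
  field_simp

/-- **The depth-weighted Whitney average as a kernel integral** in the layer `0 < d ≤ k⁻¹`
(where `d = 100ρ`): `d(z) A(z) = 100 (M³ vol B̄(0,1))⁻¹ ∫ ρ(z)⁻² 1[x ∈ B(z, Mρ(z))] g(x) dx`. [folklore] -/
theorem ofReal_depth_mul_whitneyAvg_eq (hk : 0 < k) (hM : 0 < M) {g : ℝ³ → ℝ} (hg : Continuous g)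
    (hg0 : ∀ x, 0 ≤ g x) {z : ℝ³} (hz : 0 < annDepth x₀ a b z) (hz1 : annDepth x₀ a b z ≤ k⁻¹) :
    ENNReal.ofReal (annDepth x₀ a b z * whitneyAvg x₀ a b k M g z) =
      ENNReal.ofReal (100 * (M ^ 3 * unitBallVol)⁻¹) *
        ∫⁻ x, whitneyKernel x₀ a b k M 2 z x * ENNReal.ofReal (g x) := by
  rw [whitneyAvg_eq hk hM g hz, lintegral_whitneyKernel_mul, whitneyRadius_eq_of_le hz.le hz1]
  set d := annDepth x₀ a b z with hd
  have hκ := unitBallVol_pos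
  have hint : IntegrableOn g (ball z (M * (d / 100))) :=
    (hg.continuousOn.integrableOn_compact (isCompact_closedBall z _)).mono_set ball_subset_closedBall
  have hI0 : 0 ≤ ∫ x in ball z (M * (d / 100)), g x :=
    setIntegral_nonneg measurableSet_ball fun x _ => hg0 x
  rw [← ofReal_integral_eq_lintegral_ofReal hint (Eventually.of_forall fun x => hg0 x),
    ← ENNReal.ofReal_mul (by positivity), ← ENNReal.ofReal_mul (by positivity)]
  congr 1
  rw [mul_pow, inv_pow]
  field_simp

/-- Points of a Whitney ball are at depth at least `(1 − M/100)` times the depth of the centre. [folklore] -/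
theorem annDepth_ge_of_mem_whitneyBall (hM : 0 ≤ M) {z x : ℝ³} (hz : 0 ≤ annDepth x₀ a b z)
    (hx : x ∈ ball z (M * whitneyRadius x₀ a b k z)) :
    (1 - M / 100) * annDepth x₀ a b z ≤ annDepth x₀ a b x := by
  rw [mem_ball, dist_eq_norm] at hx
  have h1 := abs_annDepth_sub_le x₀ a b x z
  rw [abs_le] at h1
  have h2 := whitneyRadius_le_annDepth_div (k := k) hz
  nlinarith [h1.1]

/-- In the region `d ≥ t` (`0 ≤ t`, `k > 0`), `η ≥ min(1, k t)`. [folklore] -/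
theorem min_le_annularRamp_of_annDepth_ge (hk : 0 < k) {t : ℝ} (ht : 0 ≤ t) {x : ℝ³}
    (hx : t ≤ annDepth x₀ a b x) : min 1 (k * t) ≤ annularRamp k a b ‖x - x₀‖ := by
  rw [annularRamp_norm_sub_eq_min hk.le (ht.trans hx)]
  exact min_le_min le_rfl (mul_le_mul_of_nonneg_left hx hk.le)

/-- **Overlap bound for the averages on the plateau side** (Tao's "bounded overlap of the
`Bᵢ`", integrated): for a continuous `g ≥ 0` and `0 < M ≤ 50`,
`∫_{d ≥ k⁻¹/16} A ≤ 32 (M³ vol B̄(0,1))⁻¹ (1 + M/100)³ (M/(1 − M/100))³ vol B(0,1) · ∫ g η`. [cite: Tao2011, §10, proof of Thm. 10.1 (bounded overlap of the Whitney balls)] -/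
theorem lintegral_whitneyAvg_plateau_le (hk : 0 < k) (hM : 0 < M) (hM' : M ≤ 50) {g : ℝ³ → ℝ}
    (hg : Continuous g) (hg0 : ∀ x, 0 ≤ g x) :
    ∫⁻ z in {z | k⁻¹ / 16 ≤ annDepth x₀ a b z}, ENNReal.ofReal (whitneyAvg x₀ a b k M g z) ≤
      ENNReal.ofReal (32 * (M ^ 3 * unitBallVol)⁻¹ * ((1 + M / 100) ^ 3 * (M / (1 - M / 100)) ^ 3)) *
        volume (ball (0 : ℝ³) 1) * ENNReal.ofReal (∫ x, g x * annularRamp k a b ‖x - x₀‖) := by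
  have hℓ : 0 < k⁻¹ := inv_pos.2 hk
  set Z : Set ℝ³ := {z | k⁻¹ / 16 ≤ annDepth x₀ a b z} with hZ
  set Z' : Set ℝ³ := {x | k⁻¹ / 32 ≤ annDepth x₀ a b x} with hZ'
  have hZm : MeasurableSet Z := (isClosed_le continuous_const (continuous_annDepth x₀ a b)).measurableSet
  have hZ'm : MeasurableSet Z' := (isClosed_le continuous_const (continuous_annDepth x₀ a b)).measurableSet
  set K := whitneyKernel x₀ a b k M 3 with hK
  set c₃ : ℝ := (1 + M / 100) ^ 3 * (M / (1 - M / 100)) ^ 3 with hc₃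
  have hc₃0 : 0 ≤ c₃ := by
    have : 0 < 1 - M / 100 := by linarith
    positivity
  set Gf : ℝ³ → ℝ≥0∞ := fun x => ENNReal.ofReal (g x) with hGf
  have hGm : Measurable Gf := ENNReal.measurable_ofReal.comp hg.measurable
  have hκ := unitBallVol_pos
  have hdepthZ : ∀ z ∈ Z, 0 < annDepth x₀ a b z := fun z hz => lt_of_lt_of_le (by positivity) hz
  -- Step 1: kernel form
  have h1 : ∫⁻ z in Z, ENNReal.ofReal (whitneyAvg x₀ a b k M g z) =
      ENNReal.ofReal ((M ^ 3 * unitBallVol)⁻¹) * ∫⁻ z in Z, ∫⁻ x, K z x * Gf x := by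
    rw [← lintegral_const_mul' _ _ ENNReal.ofReal_ne_top]
    exact setLIntegral_congr_fun hZm fun z hz => ofReal_whitneyAvg_eq hk hM hg hg0 (hdepthZ z hz)
  -- Step 2: Tonelli
  have h2 : ∫⁻ z in Z, ∫⁻ x, K z x * Gf x = ∫⁻ x, ∫⁻ z in Z, K z x * Gf x :=
    lintegral_lintegral_swap (((measurable_whitneyKernel x₀ a b k M 3).mul
      (hGm.comp measurable_snd)).aemeasurable)
  -- Step 3: the inner integral
  have h3 : ∀ x, ∫⁻ z in Z, K z x * Gf x ≤ Z'.indicator (fun x => ENNReal.ofReal c₃ *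
      volume (ball (0 : ℝ³) 1) * Gf x) x := by
    intro x
    rw [lintegral_mul_const _ (measurable_whitneyKernel_left x₀ a b k M 3 x)]
    by_cases hx : x ∈ Z'
    · rw [indicator_of_mem hx]
      refine mul_le_mul' ((setLIntegral_le_lintegral _ _).trans ?_) le_rfl
      exact lintegral_whitneyKernel_three_le hM.le (by linarith) x
    · rw [indicator_of_notMem hx]
      have : ∫⁻ z in Z, K z x = 0 := by
        refine setLIntegral_eq_zero hZm fun z hz => whitneyKernel_of_notMem fun hxz => hx ?_
        have := annDepth_ge_of_mem_whitneyBall hM.le (hdepthZ z hz).le hxz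
        show k⁻¹ / 32 ≤ annDepth x₀ a b x
        have hz' : k⁻¹ / 16 ≤ annDepth x₀ a b z := hz
        nlinarith
      rw [this, zero_mul]
  -- Step 4: the weighted mass
  have h4 : ∫⁻ x, Z'.indicator (fun x => ENNReal.ofReal c₃ * volume (ball (0 : ℝ³) 1) * Gf x) x ≤
      ENNReal.ofReal c₃ * volume (ball (0 : ℝ³) 1) * (ENNReal.ofReal 32 *
        ENNReal.ofReal (∫ x, g x * annularRamp k a b ‖x - x₀‖)) := by
    rw [lintegral_indicator hZ'm, lintegral_const_mul' _ _ (ENNReal.mul_ne_top ENNReal.ofReal_ne_top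
      measure_ball_lt_top.ne)]
    refine mul_le_mul' le_rfl ?_
    rw [ofReal_integral_eq_lintegral_ofReal
      (integrable_mul_annularRamp hk.le hg) (Eventually.of_forall fun x => mul_nonneg (hg0 x)
        (annularRamp_nonneg _ _ _ _)), ← lintegral_const_mul' _ _ ENNReal.ofReal_ne_top]
    calc ∫⁻ x in Z', Gf x ≤ ∫⁻ x in Z', ENNReal.ofReal 32 *
          ENNReal.ofReal (g x * annularRamp k a b ‖x - x₀‖) := by
          refine setLIntegral_mono' hZ'm fun x hx => ?_
          rw [hGf, ← ENNReal.ofReal_mul (by norm_num)]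
          refine ENNReal.ofReal_le_ofReal ?_
          have hη := min_le_annularRamp_of_annDepth_ge (x₀ := x₀) (a := a) (b := b) hk (by positivity) hx
          have e : k * (k⁻¹ / 32) = 1 / 32 := by field_simp
          rw [e, min_eq_right (by norm_num)] at hη
          nlinarith [hg0 x]
      _ ≤ ∫⁻ x, ENNReal.ofReal 32 * ENNReal.ofReal (g x * annularRamp k a b ‖x - x₀‖) :=
          setLIntegral_le_lintegral _ _
  calc ∫⁻ z in Z, ENNReal.ofReal (whitneyAvg x₀ a b k M g z)
      = ENNReal.ofReal ((M ^ 3 * unitBallVol)⁻¹) * ∫⁻ x, ∫⁻ z in Z, K z x * Gf x := by rw [h1, h2]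
    _ ≤ ENNReal.ofReal ((M ^ 3 * unitBallVol)⁻¹) * (ENNReal.ofReal c₃ * volume (ball (0 : ℝ³) 1) *
          (ENNReal.ofReal 32 * ENNReal.ofReal (∫ x, g x * annularRamp k a b ‖x - x₀‖))) :=
        mul_le_mul' le_rfl ((lintegral_mono h3).trans h4)
    _ = _ := by
        rw [ENNReal.ofReal_mul (by positivity : (0:ℝ) ≤ 32 * (M ^ 3 * unitBallVol)⁻¹),
          ENNReal.ofReal_mul (by norm_num : (0:ℝ) ≤ 32)]
        ring

/-- **Overlap bound for the depth-weighted averages in the layer** (Tao's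
"`Σⱼ rⱼ ∫_{10Bⱼ}|∇ω|² ≲ c^{0.1}δ⁻² ∫|∇ω|²η` by (10.20) and the bounded overlap"): for a
continuous `g ≥ 0` and `0 < M ≤ 50`,
`∫_{0 < d ≤ k⁻¹} d · A ≤ (M³ vol B̄(0,1))⁻¹ (1 + M/100)² (M/(1 − M/100))³ k⁻¹ vol B(0,1) · ∫ g η`. [cite: Tao2011, §10, proof of Thm. 10.1 ((10.20) and the bounded overlap)] -/
theorem lintegral_depth_whitneyAvg_layer_le (hk : 0 < k) (hM : 0 < M) (hM' : M ≤ 50)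
    {g : ℝ³ → ℝ} (hg : Continuous g) (hg0 : ∀ x, 0 ≤ g x) :
    ∫⁻ z in {z | 0 < annDepth x₀ a b z ∧ annDepth x₀ a b z ≤ k⁻¹},
        ENNReal.ofReal (annDepth x₀ a b z * whitneyAvg x₀ a b k M g z) ≤
      ENNReal.ofReal ((M ^ 3 * unitBallVol)⁻¹ * ((1 + M / 100) ^ 2 * (M / (1 - M / 100)) ^ 3) * k⁻¹) *
        volume (ball (0 : ℝ³) 1) * ENNReal.ofReal (∫ x, g x * annularRamp k a b ‖x - x₀‖) := by
  have hℓ : 0 < k⁻¹ := inv_pos.2 hk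
  set Z : Set ℝ³ := {z | 0 < annDepth x₀ a b z ∧ annDepth x₀ a b z ≤ k⁻¹} with hZ
  have hZm : MeasurableSet Z :=
    (measurableSet_lt measurable_const (continuous_annDepth x₀ a b).measurable).inter
      (measurableSet_le (continuous_annDepth x₀ a b).measurable measurable_const)
  set K := whitneyKernel x₀ a b k M 2 with hK
  set c₂ : ℝ := (1 + M / 100) ^ 2 * (M / (1 - M / 100)) ^ 3 with hc₂
  have hc₂0 : 0 ≤ c₂ := by
    have : 0 < 1 - M / 100 := by linarith
    positivity
  set Gf : ℝ³ → ℝ≥0∞ := fun x => ENNReal.ofReal (g x) with hGf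
  have hGm : Measurable Gf := ENNReal.measurable_ofReal.comp hg.measurable
  have hκ := unitBallVol_pos
  have h1M : 0 < 1 - M / 100 := by linarith
  have h1 : ∫⁻ z in Z, ENNReal.ofReal (annDepth x₀ a b z * whitneyAvg x₀ a b k M g z) =
      ENNReal.ofReal (100 * (M ^ 3 * unitBallVol)⁻¹) * ∫⁻ z in Z, ∫⁻ x, K z x * Gf x := by
    rw [← lintegral_const_mul' _ _ ENNReal.ofReal_ne_top]
    exact setLIntegral_congr_fun hZm fun z hz => ofReal_depth_mul_whitneyAvg_eq hk hM hg hg0 hz.1 hz.2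
  have h2 : ∫⁻ z in Z, ∫⁻ x, K z x * Gf x = ∫⁻ x, ∫⁻ z in Z, K z x * Gf x :=
    lintegral_lintegral_swap (((measurable_whitneyKernel x₀ a b k M 2).mul
      (hGm.comp measurable_snd)).aemeasurable)
  have h3 : ∀ x, ∫⁻ z in Z, K z x * Gf x ≤ ENNReal.ofReal (c₂ / (100 * k)) * volume (ball (0 : ℝ³) 1) *
      ENNReal.ofReal (g x * annularRamp k a b ‖x - x₀‖) := by
    intro x
    rw [lintegral_mul_const _ (measurable_whitneyKernel_left x₀ a b k M 2 x)]
    have hov := (setLIntegral_le_lintegral Z _).trans (lintegral_whitneyKernel_two_le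
      (x₀ := x₀) (a := a) (b := b) (k := k) hM.le (by linarith) x)
    refine (mul_le_mul' hov le_rfl).trans (le_of_eq ?_)
    have hρx := whitneyRadius_nonneg x₀ a b k x
    have e : ENNReal.ofReal ((1 + M / 100) ^ 2 * (M / (1 - M / 100)) ^ 3 * whitneyRadius x₀ a b k x) *
        Gf x = ENNReal.ofReal (c₂ / (100 * k)) * ENNReal.ofReal (g x * annularRamp k a b ‖x - x₀‖) := by
      rw [hGf, ← ENNReal.ofReal_mul (by positivity :
          (0:ℝ) ≤ (1 + M / 100) ^ 2 * (M / (1 - M / 100)) ^ 3 * whitneyRadius x₀ a b k x),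
        ← ENNReal.ofReal_mul (by positivity : (0:ℝ) ≤ c₂ / (100 * k))]
      congr 1
      rw [annularRamp_eq_mul_whitneyRadius' hk x, hc₂]
      field_simp
    calc ENNReal.ofReal ((1 + M / 100) ^ 2 * (M / (1 - M / 100)) ^ 3 * whitneyRadius x₀ a b k x) *
          volume (ball (0 : ℝ³) 1) * Gf x
        = ENNReal.ofReal ((1 + M / 100) ^ 2 * (M / (1 - M / 100)) ^ 3 * whitneyRadius x₀ a b k x) *
            Gf x * volume (ball (0 : ℝ³) 1) := by ring
      _ = ENNReal.ofReal (c₂ / (100 * k)) * ENNReal.ofReal (g x * annularRamp k a b ‖x - x₀‖) *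
            volume (ball (0 : ℝ³) 1) := by rw [e]
      _ = _ := by ring
  calc ∫⁻ z in Z, ENNReal.ofReal (annDepth x₀ a b z * whitneyAvg x₀ a b k M g z)
      = ENNReal.ofReal (100 * (M ^ 3 * unitBallVol)⁻¹) * ∫⁻ x, ∫⁻ z in Z, K z x * Gf x := by rw [h1, h2]
    _ ≤ ENNReal.ofReal (100 * (M ^ 3 * unitBallVol)⁻¹) * ∫⁻ x, ENNReal.ofReal (c₂ / (100 * k)) *
          volume (ball (0 : ℝ³) 1) * ENNReal.ofReal (g x * annularRamp k a b ‖x - x₀‖) :=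
        mul_le_mul' le_rfl (lintegral_mono h3)
    _ = _ := by
        rw [lintegral_const_mul' _ _ (ENNReal.mul_ne_top ENNReal.ofReal_ne_top measure_ball_lt_top.ne),
          ← ofReal_integral_eq_lintegral_ofReal (integrable_mul_annularRamp hk.le hg)
            (Eventually.of_forall fun x => mul_nonneg (hg0 x) (annularRamp_nonneg _ _ _ _))]
        have e : ENNReal.ofReal ((M ^ 3 * unitBallVol)⁻¹ * c₂ * k⁻¹) =
            ENNReal.ofReal (100 * (M ^ 3 * unitBallVol)⁻¹) * ENNReal.ofReal (c₂ / (100 * k)) := by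
          rw [← ENNReal.ofReal_mul (by positivity : (0:ℝ) ≤ 100 * (M ^ 3 * unitBallVol)⁻¹)]
          congr 1
          field_simp
        rw [e]
        ring

end Overlap

/-! ## The Tonelli stage -/

section Tonelli

variable {F : Type*} [NormedAddCommGroup F] [InnerProductSpace ℝ F]
variable {x₀ : ℝ³} {a b k M : ℝ}

/-- The **start set** of the chaining: the boundary layer `0 < d < k⁻¹/8` paired with the
directions within `1/4` of the inward direction. [folklore] -/
def chainStart (x₀ : ℝ³) (a b k : ℝ) : Set (ℝ³ × ℝ³) :=
  {p | (0 < annDepth x₀ a b p.1 ∧ annDepth x₀ a b p.1 < k⁻¹ / 8) ∧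
    dist p.2 (inwardDir x₀ a b p.1) < 1 / 4}

/-- The start set is measurable. [folklore] -/
theorem measurableSet_chainStart (x₀ : ℝ³) (a b k : ℝ) : MeasurableSet (chainStart x₀ a b k) := by
  have hd : Measurable fun p : ℝ³ × ℝ³ => annDepth x₀ a b p.1 :=
    (continuous_annDepth x₀ a b).measurable.comp measurable_fst
  have hdist : Measurable fun p : ℝ³ × ℝ³ => dist p.2 (inwardDir x₀ a b p.1) :=
    measurable_snd.dist ((measurable_inwardDir x₀ a b).comp measurable_fst)
  refine MeasurableSet.inter (MeasurableSet.inter (measurableSet_lt measurable_const hd)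
    (measurableSet_lt hd measurable_const)) (measurableSet_lt hdist measurable_const)

/-- The **arrival shell** at time `τ`: depths between `τ/4` and `k⁻¹/8 + 5τ/4`. [folklore] -/
def chainShell (x₀ : ℝ³) (a b k τ : ℝ) : Set ℝ³ :=
  {z | τ / 4 ≤ annDepth x₀ a b z ∧ annDepth x₀ a b z ≤ k⁻¹ / 8 + 5 / 4 * τ}

/-- The arrival shells are measurable. [folklore] -/
theorem measurableSet_chainShell (x₀ : ℝ³) (a b k τ : ℝ) : MeasurableSet (chainShell x₀ a b k τ) :=
  (measurableSet_le measurable_const (continuous_annDepth x₀ a b).measurable).inter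
    (measurableSet_le (continuous_annDepth x₀ a b).measurable measurable_const)

/-- Joint measurability of the arrival shells in `(τ, z)`. [folklore] -/
theorem measurableSet_chainShell_prod (x₀ : ℝ³) (a b k : ℝ) :
    MeasurableSet {q : ℝ × ℝ³ | q.2 ∈ chainShell x₀ a b k q.1} := by
  have hd : Measurable fun q : ℝ × ℝ³ => annDepth x₀ a b q.2 :=
    (continuous_annDepth x₀ a b).measurable.comp measurable_snd
  have h1 : Measurable fun q : ℝ × ℝ³ => q.1 / 4 := measurable_fst.div_const _
  have h2 : Measurable fun q : ℝ × ℝ³ => k⁻¹ / 8 + 5 / 4 * q.1 :=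
    measurable_const.add (measurable_fst.const_mul _)
  exact (measurableSet_le h1 hd).inter (measurableSet_le hd h2)

/-- **The innermost integral: translation invariance and the depth bounds.** For every
direction `v`, every `0 ≤ τ ≤ k⁻¹/2` and every `Φ ≥ 0`,
`∫ 1_start(y, v) Φ(y + τv) dy ≤ 1[‖v‖ ≤ 5/4] ∫_{shell(τ)} Φ`. [folklore] -/
theorem lintegral_chainStart_comp_le (hk : 0 < k) (ha : 0 < a) (hab : a + 2 * k⁻¹ < b)
    (Φ : ℝ³ → ℝ≥0∞) (v : ℝ³) {τ : ℝ} (hτ : τ ∈ Icc (0 : ℝ) (k⁻¹ / 2)) :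
    ∫⁻ y, (chainStart x₀ a b k).indicator 1 (y, v) * Φ (y + τ • v) ≤
      (closedBall (0 : ℝ³) (5 / 4)).indicator 1 v * ∫⁻ z in chainShell x₀ a b k τ, Φ z := by
  have hpt : ∀ y, (chainStart x₀ a b k).indicator 1 (y, v) * Φ (y + τ • v) ≤
      (closedBall (0 : ℝ³) (5 / 4)).indicator 1 v *
        (chainShell x₀ a b k τ).indicator Φ (y + τ • v) := by
    intro y
    by_cases hy : (y, v) ∈ chainStart x₀ a b k
    · obtain ⟨⟨hy0, hy1⟩, hv⟩ := hy
      have hP := goodPath_of_mem_layer (x₀ := x₀) hk ha hab hy0 hy1 (mem_ball.2 hv)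
      obtain ⟨hvn, s, s', _, h1, _⟩ := hP
      have h := h1 τ hτ
      have hmem : y + τ • v ∈ chainShell x₀ a b k τ := by
        refine ⟨?_, ?_⟩
        · rw [← h.1]; linarith [h.2.2.1]
        · rw [← h.1]; linarith [h.2.2.2]
      rw [indicator_of_mem (show (y, v) ∈ chainStart x₀ a b k from ⟨⟨hy0, hy1⟩, hv⟩),
        indicator_of_mem (mem_closedBall_zero_iff.2 hvn), indicator_of_mem hmem, Pi.one_apply,
        Pi.one_apply]
    · rw [indicator_of_notMem hy, zero_mul]
      exact bot_le
  calc ∫⁻ y, (chainStart x₀ a b k).indicator 1 (y, v) * Φ (y + τ • v)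
      ≤ ∫⁻ y, (closedBall (0 : ℝ³) (5 / 4)).indicator 1 v *
          (chainShell x₀ a b k τ).indicator Φ (y + τ • v) := lintegral_mono hpt
    _ = (closedBall (0 : ℝ³) (5 / 4)).indicator 1 v *
          ∫⁻ y, (chainShell x₀ a b k τ).indicator Φ (y + τ • v) := by
        rw [lintegral_const_mul' _ _ (by
          by_cases hv : v ∈ closedBall (0 : ℝ³) (5 / 4)
          · rw [indicator_of_mem hv]; exact ENNReal.one_ne_top
          · rw [indicator_of_notMem hv]; exact ENNReal.zero_ne_top)]
    _ = (closedBall (0 : ℝ³) (5 / 4)).indicator 1 v * ∫⁻ z in chainShell x₀ a b k τ, Φ z := by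
        rw [lintegral_add_right_eq_self (fun z => (chainShell x₀ a b k τ).indicator Φ z) (τ • v),
          lintegral_indicator (measurableSet_chainShell x₀ a b k τ)]

/-- **The time spent in the shells**: for every point `z`,
`∫_{0 < τ ≤ k⁻¹/2} 1[z ∈ shell(τ)] dτ ≤ 1[0 < d(z) ≤ 3k⁻¹/4] · 4 d(z)`. [folklore] -/
theorem lintegral_indicator_chainShell_le (hk : 0 < k) (z : ℝ³) :
    ∫⁻ τ in Ioc (0 : ℝ) (k⁻¹ / 2), (chainShell x₀ a b k τ).indicator (1 : ℝ³ → ℝ≥0∞) z ≤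
      {z : ℝ³ | 0 < annDepth x₀ a b z ∧ annDepth x₀ a b z ≤ 3 * k⁻¹ / 4}.indicator
        (fun z => ENNReal.ofReal (4 * annDepth x₀ a b z)) z := by
  have hℓ : 0 < k⁻¹ := inv_pos.2 hk
  set d := annDepth x₀ a b z with hd
  by_cases hz : z ∈ {z : ℝ³ | 0 < annDepth x₀ a b z ∧ annDepth x₀ a b z ≤ 3 * k⁻¹ / 4}
  · rw [indicator_of_mem hz]
    calc ∫⁻ τ in Ioc (0 : ℝ) (k⁻¹ / 2), (chainShell x₀ a b k τ).indicator (1 : ℝ³ → ℝ≥0∞) z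
        ≤ ∫⁻ τ in Ioc (0 : ℝ) (k⁻¹ / 2), (Ioc (0 : ℝ) (4 * d)).indicator 1 τ := by
          refine setLIntegral_mono' measurableSet_Ioc fun τ hτ => ?_
          by_cases hτz : z ∈ chainShell x₀ a b k τ
          · have : τ ∈ Ioc (0 : ℝ) (4 * d) := ⟨hτ.1, by have := hτz.1; rw [← hd] at this; linarith⟩
            rw [indicator_of_mem hτz, indicator_of_mem this]
            simp
          · rw [indicator_of_notMem hτz]; exact bot_le
      _ ≤ ∫⁻ τ, (Ioc (0 : ℝ) (4 * d)).indicator 1 τ := setLIntegral_le_lintegral _ _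
      _ = ENNReal.ofReal (4 * d) := by
          rw [lintegral_indicator_one measurableSet_Ioc, Real.volume_Ioc, sub_zero]
  · rw [indicator_of_notMem hz]
    refine le_of_eq (setLIntegral_eq_zero measurableSet_Ioc fun τ hτ => ?_)
    have hτz : z ∉ chainShell x₀ a b k τ := by
      intro hτz
      refine hz ⟨?_, ?_⟩
      · have := hτz.1; linarith [hτ.1]
      · have := hτz.2; linarith [hτ.2]
    simp only [indicator_of_notMem hτz, Pi.zero_apply]

/-- The normalising factor `s₀(M) = (50 vol B̄(0,1) M³)^{-1/2}` of the sup bound. [folklore] -/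
def chainS₀ (M : ℝ) : ℝ := Real.sqrt (1 / (50 * unitBallVol * M ^ 3))

/-- `s₀ ≥ 0`. [folklore] -/
theorem chainS₀_nonneg (M : ℝ) : 0 ≤ chainS₀ M := Real.sqrt_nonneg _

omit [InnerProductSpace ℝ F] in
/-- **Sup bound on the plateau side**: for `d(z) ≥ k⁻¹/16`,
`A(z)^{1/2} ≤ (∫‖f‖²η · k³)^{1/2} · 1600² s₀(M)`. [cite: Tao2011, §10, proof of Thm. 10.1 ((10.23))] -/
theorem sqrt_whitneyAvg_le_plateau (hk : 0 < k) (hM : 0 < M) (hM' : M ≤ 50) {f : ℝ³ → F}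
    (hf : Continuous f) {z : ℝ³} (hz : k⁻¹ / 16 ≤ annDepth x₀ a b z) :
    Real.sqrt (whitneyAvg x₀ a b k M (fun x => ‖f x‖ ^ 2) z) ≤
      Real.sqrt ((∫ x, ‖f x‖ ^ 2 * annularRamp k a b ‖x - x₀‖) * k ^ 3) * (1600 ^ 2 * chainS₀ M) := by
  have hℓ : 0 < k⁻¹ := inv_pos.2 hk
  have hκ := unitBallVol_pos
  have hz0 : 0 < annDepth x₀ a b z := lt_of_lt_of_le (by positivity) hz
  set W := ∫ x, ‖f x‖ ^ 2 * annularRamp k a b ‖x - x₀‖ with hW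
  have hW0 : 0 ≤ W := integral_nonneg fun x => mul_nonneg (sq_nonneg _) (annularRamp_nonneg _ _ _ _)
  set ρ := whitneyRadius x₀ a b k z with hρ
  have hρ0 : 0 < ρ := whitneyRadius_pos hk hz0
  have hρlo : k⁻¹ / 1600 ≤ ρ := by
    rw [hρ, whitneyRadius_def, max_eq_right (le_min hz0.le hℓ.le)]
    have : k⁻¹ / 16 ≤ min (annDepth x₀ a b z) k⁻¹ := le_min hz (by linarith)
    linarith
  have hA := whitneyAvg_le (x₀ := x₀) (a := a) (b := b) (g := fun x => ‖f x‖ ^ 2) hk hM hM'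
    (by fun_prop) (fun x => sq_nonneg _) hz0
  rw [← hW, ← hρ] at hA
  have hkρ : 1 ≤ 1600 * k * ρ := by
    have := mul_le_mul_of_nonneg_left hρlo (by positivity : (0:ℝ) ≤ 1600 * k)
    rw [show 1600 * k * (k⁻¹ / 1600) = 1 by field_simp] at this
    exact this
  have hA' : whitneyAvg x₀ a b k M (fun x => ‖f x‖ ^ 2) z ≤
      W * k ^ 3 * (1600 ^ 2 * chainS₀ M) ^ 2 := by
    refine hA.trans ?_
    rw [mul_pow, chainS₀, Real.sq_sqrt (by positivity), div_le_iff₀ (by positivity)]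
    have h4 : 1 ≤ (1600 * k * ρ) ^ 4 := one_le_pow₀ hkρ
    have e : W * k ^ 3 * ((1600 ^ 2) ^ 2 * (1 / (50 * unitBallVol * M ^ 3))) *
        (50 * unitBallVol * M ^ 3 * k * ρ ^ 4) = W * (1600 * k * ρ) ^ 4 := by
      field_simp
    rw [e]
    nlinarith
  calc Real.sqrt (whitneyAvg x₀ a b k M (fun x => ‖f x‖ ^ 2) z)
      ≤ Real.sqrt (W * k ^ 3 * (1600 ^ 2 * chainS₀ M) ^ 2) := Real.sqrt_le_sqrt hA'
    _ = Real.sqrt (W * k ^ 3) * (1600 ^ 2 * chainS₀ M) := by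
        rw [Real.sqrt_mul (by positivity), Real.sqrt_sq (mul_nonneg (by norm_num) (chainS₀_nonneg M))]

omit [InnerProductSpace ℝ F] in
/-- **Sup bound in the layer**: for `0 < d(z) ≤ k⁻¹`,
`d(z)² A(z)^{1/2} ≤ 10⁴ (∫‖f‖²η / k)^{1/2} s₀(M)`. [cite: Tao2011, §10, proof of Thm. 10.1 ((10.23))] -/
theorem sq_depth_mul_sqrt_whitneyAvg_le (hk : 0 < k) (hM : 0 < M) (hM' : M ≤ 50) {f : ℝ³ → F}
    (hf : Continuous f) {z : ℝ³} (hz : 0 < annDepth x₀ a b z) (hz1 : annDepth x₀ a b z ≤ k⁻¹) :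
    annDepth x₀ a b z ^ 2 * Real.sqrt (whitneyAvg x₀ a b k M (fun x => ‖f x‖ ^ 2) z) ≤
      10 ^ 4 * (Real.sqrt ((∫ x, ‖f x‖ ^ 2 * annularRamp k a b ‖x - x₀‖) / k) * chainS₀ M) := by
  have hκ := unitBallVol_pos
  set W := ∫ x, ‖f x‖ ^ 2 * annularRamp k a b ‖x - x₀‖ with hW
  have hW0 : 0 ≤ W := integral_nonneg fun x => mul_nonneg (sq_nonneg _) (annularRamp_nonneg _ _ _ _)
  set d := annDepth x₀ a b z with hd
  have hρ : whitneyRadius x₀ a b k z = d / 100 := whitneyRadius_eq_of_le hz.le hz1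
  have hA := whitneyAvg_le (x₀ := x₀) (a := a) (b := b) (g := fun x => ‖f x‖ ^ 2) hk hM hM'
    (by fun_prop) (fun x => sq_nonneg _) hz
  rw [← hW, hρ] at hA
  have hA' : whitneyAvg x₀ a b k M (fun x => ‖f x‖ ^ 2) z ≤
      (10 ^ 4 * (Real.sqrt (W / k) * chainS₀ M) / d ^ 2) ^ 2 := by
    refine hA.trans (le_of_eq ?_)
    have hs : (Real.sqrt (W / k) * Real.sqrt (1 / (50 * unitBallVol * M ^ 3))) ^ 2 =
        (W / k) * (1 / (50 * unitBallVol * M ^ 3)) := by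
      rw [mul_pow, Real.sq_sqrt (by positivity), Real.sq_sqrt (by positivity)]
    rw [chainS₀, div_pow, div_pow, mul_pow, hs]
    field_simp
    ring
  have h0 : 0 ≤ 10 ^ 4 * (Real.sqrt (W / k) * chainS₀ M) / d ^ 2 := by
    have := chainS₀_nonneg M; positivity
  calc d ^ 2 * Real.sqrt (whitneyAvg x₀ a b k M (fun x => ‖f x‖ ^ 2) z)
      ≤ d ^ 2 * (10 ^ 4 * (Real.sqrt (W / k) * chainS₀ M) / d ^ 2) := by
        refine mul_le_mul_of_nonneg_left ?_ (sq_nonneg _)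
        calc _ ≤ Real.sqrt ((10 ^ 4 * (Real.sqrt (W / k) * chainS₀ M) / d ^ 2) ^ 2) :=
              Real.sqrt_le_sqrt hA'
          _ = _ := Real.sqrt_sq h0
    _ = 10 ^ 4 * (Real.sqrt (W / k) * chainS₀ M) := by
        field_simp

end Tonelli

/-! ## Assembly of the layer estimate -/

section Assembly

variable {F : Type*} [NormedAddCommGroup F] [InnerProductSpace ℝ F]
variable {x₀ : ℝ³} {a b k M : ℝ}

/-- Indicators of `1` are finite. [folklore] -/
theorem indicator_one_ne_top {α : Type*} (s : Set α) (p : α) : s.indicator (1 : α → ℝ≥0∞) p ≠ ⊤ := by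
  unfold Set.indicator
  split_ifs
  · exact ENNReal.one_ne_top
  · exact ENNReal.zero_ne_top

/-- **Fubini for the chaining**: integrating the innermost bound over directions and times,
`∫∫ 1_start(y,v) (∫_I Φ(y + τv) dτ) dv dy ≤ vol B̄(0, 5/4) ∫_I ∫_{shell(τ)} Φ dτ`
for every measurable `I ⊆ [0, k⁻¹/2]` and measurable `Φ ≥ 0`. [folklore] -/
theorem lintegral_lintegral_chainStart_le (hk : 0 < k) (ha : 0 < a) (hab : a + 2 * k⁻¹ < b)
    {I : Set ℝ} (hI : I ⊆ Icc 0 (k⁻¹ / 2)) (hIm : MeasurableSet I) {Φ : ℝ³ → ℝ≥0∞}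
    (hΦ : Measurable Φ) :
    ∫⁻ y, ∫⁻ v, (chainStart x₀ a b k).indicator 1 (y, v) * ∫⁻ τ in I, Φ (y + τ • v) ≤
      volume (closedBall (0 : ℝ³) (5 / 4)) * ∫⁻ τ in I, ∫⁻ z in chainShell x₀ a b k τ, Φ z := by
  set E := chainStart x₀ a b k with hE
  have hEm : MeasurableSet E := measurableSet_chainStart x₀ a b k
  set H : (ℝ³ × ℝ³) × ℝ → ℝ≥0∞ := fun q => E.indicator 1 q.1 * Φ (q.1.1 + q.2 • q.1.2) with hH
  have hHm : Measurable H := by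
    refine ((measurable_one.indicator hEm).comp measurable_fst).mul (hΦ.comp ?_)
    exact ((continuous_fst.comp continuous_fst).add
      (continuous_snd.smul (continuous_snd.comp continuous_fst))).measurable
  -- Step i: constants inside
  have h1 : ∀ y v, E.indicator 1 (y, v) * ∫⁻ τ in I, Φ (y + τ • v) =
      ∫⁻ τ in I, H ((y, v), τ) := fun y v => by
    rw [hH]; exact (lintegral_const_mul' _ _ (indicator_one_ne_top _ _)).symm
  simp_rw [h1]
  -- Step ii: swap `y` and `v`
  have h2 : ∫⁻ y, ∫⁻ v, ∫⁻ τ in I, H ((y, v), τ) = ∫⁻ v, ∫⁻ y, ∫⁻ τ in I, H ((y, v), τ) :=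
    lintegral_lintegral_swap ((hHm.lintegral_prod_right' (ν := volume.restrict I)).aemeasurable)
  rw [h2]
  -- Step iii: swap `y` and `τ`, bound the innermost integral, pull out the indicator in `v`
  have h3 : ∀ v, ∫⁻ y, ∫⁻ τ in I, H ((y, v), τ) ≤ (closedBall (0 : ℝ³) (5 / 4)).indicator 1 v *
      ∫⁻ τ in I, ∫⁻ z in chainShell x₀ a b k τ, Φ z := by
    intro v
    have hm : Measurable (uncurry fun (y : ℝ³) (τ : ℝ) => H ((y, v), τ)) :=
      hHm.comp ((measurable_fst.prodMk measurable_const).prodMk measurable_snd)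
    rw [lintegral_lintegral_swap (μ := volume) (ν := volume.restrict I) hm.aemeasurable,
      ← lintegral_const_mul' _ _ (indicator_one_ne_top _ _)]
    refine setLIntegral_mono' hIm fun τ hτ => ?_
    rw [hH]
    exact lintegral_chainStart_comp_le hk ha hab Φ v (hI hτ)
  calc ∫⁻ v, ∫⁻ y, ∫⁻ τ in I, H ((y, v), τ)
      ≤ ∫⁻ v, (closedBall (0 : ℝ³) (5 / 4)).indicator 1 v *
          ∫⁻ τ in I, ∫⁻ z in chainShell x₀ a b k τ, Φ z := lintegral_mono h3
    _ = volume (closedBall (0 : ℝ³) (5 / 4)) * ∫⁻ τ in I, ∫⁻ z in chainShell x₀ a b k τ, Φ z := by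
        rw [lintegral_mul_const _ (measurable_one.indicator measurableSet_closedBall),
          lintegral_indicator_one measurableSet_closedBall]

/-- The volume of the unit ball as `ofReal`. [folklore] -/
theorem volume_unitBall_eq_ofReal : volume (ball (0 : ℝ³) 1) = ENNReal.ofReal unitBallVol := by
  rw [unitBallVol, ENNReal.ofReal_toReal measure_closedBall_lt_top.ne,
    Measure.addHaar_unitClosedBall_eq_addHaar_unitBall]

/-- The volume of a ball as `ofReal`. [folklore] -/
theorem volume_ball_eq_ofReal (x : ℝ³) {r : ℝ} (hr : 0 ≤ r) :
    volume (ball x r) = ENNReal.ofReal (r ^ 3 * unitBallVol) := by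
  rw [volume_ball_eq x hr, volume_unitBall_eq_ofReal, ← ENNReal.ofReal_mul (pow_nonneg hr 3)]

/-- The volume of a closed ball as `ofReal`. [folklore] -/
theorem volume_closedBall_eq_ofReal (x : ℝ³) {r : ℝ} (hr : 0 ≤ r) :
    volume (closedBall x r) = ENNReal.ofReal (r ^ 3 * unitBallVol) := by
  rw [Measure.addHaar_closedBall volume x hr, finrank_euclideanSpace_fin, unitBallVol,
    ENNReal.ofReal_mul (pow_nonneg hr 3), ENNReal.ofReal_toReal measure_closedBall_lt_top.ne,
    Measure.addHaar_unitClosedBall_eq_addHaar_unitBall]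

/-- The constant `c₃(M) = (1 + M/100)³ (M/(1 − M/100))³` of the overlap bound with exponent `3`. [folklore] -/
def chainC₃ (M : ℝ) : ℝ := (1 + M / 100) ^ 3 * (M / (1 - M / 100)) ^ 3

/-- The constant `c₂(M) = (1 + M/100)² (M/(1 − M/100))³` of the overlap bound with exponent `2`. [folklore] -/
def chainC₂ (M : ℝ) : ℝ := (1 + M / 100) ^ 2 * (M / (1 - M / 100)) ^ 3

/-- `c₃ ≥ 0` for `0 ≤ M ≤ 50`. [folklore] -/
theorem chainC₃_nonneg (hM : 0 ≤ M) (hM' : M ≤ 50) : 0 ≤ chainC₃ M := by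
  have : 0 < 1 - M / 100 := by linarith
  unfold chainC₃; positivity

/-- `c₂ ≥ 0` for `0 ≤ M ≤ 50`. [folklore] -/
theorem chainC₂_nonneg (hM : 0 ≤ M) (hM' : M ≤ 50) : 0 ≤ chainC₂ M := by
  have : 0 < 1 - M / 100 := by linarith
  unfold chainC₂; positivity

/-- The plateau overlap bound, constants merged: `∫_{d ≥ k⁻¹/16} A ≤ 32 c₃(M)/M³ · ∫ g η`. [folklore] -/
theorem lintegral_whitneyAvg_plateau_le' (hk : 0 < k) (hM : 0 < M) (hM' : M ≤ 50) {g : ℝ³ → ℝ}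
    (hg : Continuous g) (hg0 : ∀ x, 0 ≤ g x) :
    ∫⁻ z in {z | k⁻¹ / 16 ≤ annDepth x₀ a b z}, ENNReal.ofReal (whitneyAvg x₀ a b k M g z) ≤
      ENNReal.ofReal (32 * chainC₃ M / M ^ 3 * ∫ x, g x * annularRamp k a b ‖x - x₀‖) := by
  have hκ := unitBallVol_pos
  have hc := chainC₃_nonneg hM.le hM'
  refine (lintegral_whitneyAvg_plateau_le hk hM hM' hg hg0).trans (le_of_eq ?_)
  rw [volume_unitBall_eq_ofReal, ← chainC₃, ← ENNReal.ofReal_mul (by positivity),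
    ← ENNReal.ofReal_mul (by positivity)]
  congr 1
  field_simp

/-- The layer overlap bound, constants merged: `∫_{0 < d ≤ k⁻¹} d·A ≤ c₂(M)/(M³ k) · ∫ g η`. [folklore] -/
theorem lintegral_depth_whitneyAvg_layer_le' (hk : 0 < k) (hM : 0 < M) (hM' : M ≤ 50)
    {g : ℝ³ → ℝ} (hg : Continuous g) (hg0 : ∀ x, 0 ≤ g x) :
    ∫⁻ z in {z | 0 < annDepth x₀ a b z ∧ annDepth x₀ a b z ≤ k⁻¹},
        ENNReal.ofReal (annDepth x₀ a b z * whitneyAvg x₀ a b k M g z) ≤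
      ENNReal.ofReal (chainC₂ M / (M ^ 3 * k) * ∫ x, g x * annularRamp k a b ‖x - x₀‖) := by
  have hκ := unitBallVol_pos
  have hc := chainC₂_nonneg hM.le hM'
  refine (lintegral_depth_whitneyAvg_layer_le hk hM hM' hg hg0).trans (le_of_eq ?_)
  rw [volume_unitBall_eq_ofReal, ← chainC₂, ← ENNReal.ofReal_mul (by positivity),
    ← ENNReal.ofReal_mul (by positivity)]
  congr 1
  field_simp

/-- **Term I after the time integral**: on `τ ∈ (k⁻¹/4, k⁻¹/2]` the shells lie in
`{k⁻¹/16 ≤ d ≤ 3k⁻¹/4}`, where `Φ₁ ≤ (3k⁻¹/4)·(sup A^{1/2})·A`; with the plateau overlap bound,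
`∫_{(k⁻¹/4, k⁻¹/2]} ∫_{shell(τ)} Φ₁ ≤ (k⁻¹/4)(3k⁻¹/4)(W k³)^{1/2} 1600² s₀ · 32 c₃/M³ · W`,
`W = ∫‖f‖²η`. [cite: Tao2011, §10, proof of Thm. 10.1 (p. 33, "Σ_{i:a(i)=j} rᵢ⁴ ≲ rⱼ⁴" and (10.22)–(10.23))] -/
theorem lintegral_shell_chainPhi₁_le {f : ℝ³ → F} (hf : ContDiff ℝ 1 f) (hk : 0 < k) (hM : 0 < M)
    (hM' : M ≤ 50) :
    ∫⁻ τ in Ioc (k⁻¹ / 4) (k⁻¹ / 2), ∫⁻ z in chainShell x₀ a b k τ,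
        ENNReal.ofReal (chainPhi₁ x₀ a b k M f z) ≤
      ENNReal.ofReal (k⁻¹ / 4 * (3 * k⁻¹ / 4 *
        (Real.sqrt ((∫ x, ‖f x‖ ^ 2 * annularRamp k a b ‖x - x₀‖) * k ^ 3) * (1600 ^ 2 * chainS₀ M)) *
        (32 * chainC₃ M / M ^ 3 * ∫ x, ‖f x‖ ^ 2 * annularRamp k a b ‖x - x₀‖))) := by
  have hℓ : 0 < k⁻¹ := inv_pos.2 hk
  have hfc := hf.continuous
  have hc₃ := chainC₃_nonneg hM.le hM'
  set W := ∫ x, ‖f x‖ ^ 2 * annularRamp k a b ‖x - x₀‖ with hW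
  have hW0 : 0 ≤ W := integral_nonneg fun x => mul_nonneg (sq_nonneg _) (annularRamp_nonneg _ _ _ _)
  set Sg₁ : ℝ := Real.sqrt (W * k ^ 3) * (1600 ^ 2 * chainS₀ M) with hSg₁
  have hSg₁0 : 0 ≤ Sg₁ := mul_nonneg (Real.sqrt_nonneg _) (mul_nonneg (by norm_num) (chainS₀_nonneg M))
  set S' : Set ℝ³ := {z | k⁻¹ / 16 ≤ annDepth x₀ a b z ∧ annDepth x₀ a b z ≤ 3 * k⁻¹ / 4} with hS'
  set A := whitneyAvg x₀ a b k M (fun x => ‖f x‖ ^ 2) with hA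
  have hA0 : ∀ z, 0 ≤ A z := fun z => whitneyAvg_nonneg (fun _ => sq_nonneg _) z
  -- the inner integrals are bounded by the integral over `S'`
  have h1 : ∀ τ ∈ Ioc (k⁻¹ / 4) (k⁻¹ / 2), ∫⁻ z in chainShell x₀ a b k τ,
      ENNReal.ofReal (chainPhi₁ x₀ a b k M f z) ≤ ∫⁻ z in S', ENNReal.ofReal (chainPhi₁ x₀ a b k M f z) := by
    intro τ hτ
    refine lintegral_mono_set fun z hz => ⟨?_, ?_⟩
    · have := hz.1; linarith [hτ.1]
    · have := hz.2; linarith [hτ.2]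
  -- pointwise on `S'`
  have h2 : ∀ z ∈ S', ENNReal.ofReal (chainPhi₁ x₀ a b k M f z) ≤
      ENNReal.ofReal (3 * k⁻¹ / 4 * Sg₁) * ENNReal.ofReal (A z) := by
    intro z hz
    rw [← ENNReal.ofReal_mul (by positivity), chainPhi₁_def, ← hA]
    refine ENNReal.ofReal_le_ofReal ?_
    have hsq : Real.sqrt (A z) ≤ Sg₁ := by
      rw [hSg₁, hA, hW]; exact sqrt_whitneyAvg_le_plateau hk hM hM' hfc hz.1
    have hd0 : 0 ≤ annDepth x₀ a b z := le_trans (by positivity) hz.1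
    calc annDepth x₀ a b z * (A z * Real.sqrt (A z)) ≤ (3 * k⁻¹ / 4) * (A z * Sg₁) := by
          refine mul_le_mul hz.2 (mul_le_mul_of_nonneg_left hsq (hA0 z))
            (mul_nonneg (hA0 z) (Real.sqrt_nonneg _)) (by positivity)
      _ = 3 * k⁻¹ / 4 * Sg₁ * A z := by ring
  have h3 : ∫⁻ z in S', ENNReal.ofReal (chainPhi₁ x₀ a b k M f z) ≤
      ENNReal.ofReal (3 * k⁻¹ / 4 * Sg₁) * ENNReal.ofReal (32 * chainC₃ M / M ^ 3 * W) := by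
    have hS'm : MeasurableSet S' :=
      (measurableSet_le measurable_const (continuous_annDepth x₀ a b).measurable).inter
        (measurableSet_le (continuous_annDepth x₀ a b).measurable measurable_const)
    calc ∫⁻ z in S', ENNReal.ofReal (chainPhi₁ x₀ a b k M f z)
        ≤ ∫⁻ z in S', ENNReal.ofReal (3 * k⁻¹ / 4 * Sg₁) * ENNReal.ofReal (A z) := setLIntegral_mono' hS'm h2
      _ = ENNReal.ofReal (3 * k⁻¹ / 4 * Sg₁) * ∫⁻ z in S', ENNReal.ofReal (A z) :=
          lintegral_const_mul' _ _ ENNReal.ofReal_ne_top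
      _ ≤ ENNReal.ofReal (3 * k⁻¹ / 4 * Sg₁) *
            ∫⁻ z in {z | k⁻¹ / 16 ≤ annDepth x₀ a b z}, ENNReal.ofReal (A z) :=
          mul_le_mul' le_rfl (lintegral_mono_set fun z hz => hz.1)
      _ ≤ _ := mul_le_mul' le_rfl (by
          rw [hA, hW]
          exact lintegral_whitneyAvg_plateau_le' hk hM hM' (by fun_prop) fun x => sq_nonneg _)
  calc ∫⁻ τ in Ioc (k⁻¹ / 4) (k⁻¹ / 2), ∫⁻ z in chainShell x₀ a b k τ,
        ENNReal.ofReal (chainPhi₁ x₀ a b k M f z)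
      ≤ ∫⁻ τ in Ioc (k⁻¹ / 4) (k⁻¹ / 2), ∫⁻ z in S', ENNReal.ofReal (chainPhi₁ x₀ a b k M f z) :=
        setLIntegral_mono' measurableSet_Ioc h1
    _ = ENNReal.ofReal (k⁻¹ / 4) * ∫⁻ z in S', ENNReal.ofReal (chainPhi₁ x₀ a b k M f z) := by
        rw [setLIntegral_const, Real.volume_Ioc, mul_comm]
        congr 2
        ring
    _ ≤ ENNReal.ofReal (k⁻¹ / 4) * (ENNReal.ofReal (3 * k⁻¹ / 4 * Sg₁) *
          ENNReal.ofReal (32 * chainC₃ M / M ^ 3 * W)) := mul_le_mul' le_rfl h3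
    _ = _ := by
        rw [← ENNReal.ofReal_mul (by positivity), ← ENNReal.ofReal_mul (by positivity)]

/-- **Term II after the time integral**: exchanging the time and space integrals, each point
`z` of the layer `0 < d ≤ 3k⁻¹/4` is met for a time at most `4 d(z)`, and there
`4d · Φ₂ = 4 d³ A^{1/2} G ≤ 4·10⁴ (W/k)^{1/2} s₀ · d G`; with the layer overlap bound,
`∫_{(0, k⁻¹/2]} ∫_{shell(τ)} Φ₂ ≤ 4·10⁴ (W/k)^{1/2} s₀ · c₂/(M³k) · Y`, `Y = ∫‖Df‖²η`. [cite: Tao2011, §10, proof of Thm. 10.1 (p. 33, "Σ_k (1+k)^{10} Σ_{i:pᵏ(i)=j} rᵢ⁴ ≲ rⱼ⁴" and (10.20))] -/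
theorem lintegral_shell_chainPhi₂_le {f : ℝ³ → F} (hf : ContDiff ℝ 1 f) (hk : 0 < k) (hM : 0 < M)
    (hM' : M ≤ 50) :
    ∫⁻ τ in Ioc 0 (k⁻¹ / 2), ∫⁻ z in chainShell x₀ a b k τ,
        ENNReal.ofReal (chainPhi₂ x₀ a b k M f z) ≤
      ENNReal.ofReal (4 * 10 ^ 4 *
        (Real.sqrt ((∫ x, ‖f x‖ ^ 2 * annularRamp k a b ‖x - x₀‖) / k) * chainS₀ M) *
        (chainC₂ M / (M ^ 3 * k) * ∫ x, ‖fderiv ℝ f x‖ ^ 2 * annularRamp k a b ‖x - x₀‖)) := by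
  have hℓ : 0 < k⁻¹ := inv_pos.2 hk
  have hfc := hf.continuous
  have hDfc : Continuous (fderiv ℝ f) := hf.continuous_fderiv one_ne_zero
  have hc₂ := chainC₂_nonneg hM.le hM'
  set W := ∫ x, ‖f x‖ ^ 2 * annularRamp k a b ‖x - x₀‖ with hW
  set Y := ∫ x, ‖fderiv ℝ f x‖ ^ 2 * annularRamp k a b ‖x - x₀‖ with hY
  have hW0 : 0 ≤ W := integral_nonneg fun x => mul_nonneg (sq_nonneg _) (annularRamp_nonneg _ _ _ _)
  have hY0 : 0 ≤ Y := integral_nonneg fun x => mul_nonneg (sq_nonneg _) (annularRamp_nonneg _ _ _ _)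
  set Sg₂ : ℝ := Real.sqrt (W / k) * chainS₀ M with hSg₂
  have hSg₂0 : 0 ≤ Sg₂ := mul_nonneg (Real.sqrt_nonneg _) (chainS₀_nonneg M)
  set S'' : Set ℝ³ := {z | 0 < annDepth x₀ a b z ∧ annDepth x₀ a b z ≤ 3 * k⁻¹ / 4} with hS''
  have hS''m : MeasurableSet S'' :=
    (measurableSet_lt measurable_const (continuous_annDepth x₀ a b).measurable).inter
      (measurableSet_le (continuous_annDepth x₀ a b).measurable measurable_const)
  set A := whitneyAvg x₀ a b k M (fun x => ‖f x‖ ^ 2) with hA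
  set G := whitneyAvg x₀ a b k M (fun x => ‖fderiv ℝ f x‖ ^ 2) with hG
  have hG0 : ∀ z, 0 ≤ G z := fun z => whitneyAvg_nonneg (fun _ => sq_nonneg _) z
  set Φ₂ : ℝ³ → ℝ≥0∞ := fun z => ENNReal.ofReal (chainPhi₂ x₀ a b k M f z) with hΦ₂
  have hΦ₂m : Measurable Φ₂ := ENNReal.measurable_ofReal.comp (continuous_chainPhi₂ hf).measurable
  -- exchange `τ` and `z`
  set T : Set (ℝ × ℝ³) := {q | q.2 ∈ chainShell x₀ a b k q.1} with hT
  have hTm : MeasurableSet T := measurableSet_chainShell_prod x₀ a b k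
  have h1 : ∫⁻ τ in Ioc 0 (k⁻¹ / 2), ∫⁻ z in chainShell x₀ a b k τ, Φ₂ z =
      ∫⁻ τ in Ioc 0 (k⁻¹ / 2), ∫⁻ z, T.indicator 1 (τ, z) * Φ₂ z := by
    refine lintegral_congr fun τ => ?_
    rw [← lintegral_indicator (measurableSet_chainShell x₀ a b k τ)]
    refine lintegral_congr fun z => ?_
    by_cases hz : z ∈ chainShell x₀ a b k τ
    · rw [indicator_of_mem hz, indicator_of_mem (show (τ, z) ∈ T from hz), Pi.one_apply, one_mul]
    · rw [indicator_of_notMem hz, indicator_of_notMem (show (τ, z) ∉ T from hz), zero_mul]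
  have h2 : ∫⁻ τ in Ioc 0 (k⁻¹ / 2), ∫⁻ z, T.indicator 1 (τ, z) * Φ₂ z =
      ∫⁻ z, ∫⁻ τ in Ioc 0 (k⁻¹ / 2), T.indicator 1 (τ, z) * Φ₂ z :=
    lintegral_lintegral_swap (((measurable_one.indicator hTm).mul (hΦ₂m.comp measurable_snd)).aemeasurable)
  -- the time spent at `z`
  have h3 : ∀ z, ∫⁻ τ in Ioc 0 (k⁻¹ / 2), T.indicator 1 (τ, z) * Φ₂ z ≤
      S''.indicator (fun z => ENNReal.ofReal (4 * annDepth x₀ a b z)) z * Φ₂ z := by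
    intro z
    have hmeas : Measurable (fun τ : ℝ => T.indicator (1 : ℝ × ℝ³ → ℝ≥0∞) (τ, z)) :=
      (measurable_one.indicator hTm).comp (measurable_id.prodMk measurable_const)
    rw [lintegral_mul_const _ hmeas]
    refine mul_le_mul' ?_ le_rfl
    have e : ∀ τ, T.indicator (1 : ℝ × ℝ³ → ℝ≥0∞) (τ, z) =
        (chainShell x₀ a b k τ).indicator (1 : ℝ³ → ℝ≥0∞) z := by
      intro τ
      by_cases hz : z ∈ chainShell x₀ a b k τ
      · rw [indicator_of_mem hz, indicator_of_mem (show (τ, z) ∈ T from hz)]; rfl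
      · rw [indicator_of_notMem hz, indicator_of_notMem (show (τ, z) ∉ T from hz)]
    simp_rw [e]
    exact lintegral_indicator_chainShell_le hk z
  -- pointwise on `S''`
  have h4 : ∀ z ∈ S'', ENNReal.ofReal (4 * annDepth x₀ a b z) * Φ₂ z ≤
      ENNReal.ofReal (4 * 10 ^ 4 * Sg₂) * ENNReal.ofReal (annDepth x₀ a b z * G z) := by
    intro z hz
    have hd0 : 0 ≤ annDepth x₀ a b z := hz.1.le
    rw [hΦ₂, ← ENNReal.ofReal_mul (by positivity), ← ENNReal.ofReal_mul (by positivity), chainPhi₂_def,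
      ← hA, ← hG]
    refine ENNReal.ofReal_le_ofReal ?_
    have hsq : annDepth x₀ a b z ^ 2 * Real.sqrt (A z) ≤ 10 ^ 4 * Sg₂ := by
      rw [hSg₂, hA, hW]
      exact sq_depth_mul_sqrt_whitneyAvg_le hk hM hM' hfc hz.1 (by linarith [hz.2])
    calc 4 * annDepth x₀ a b z * (annDepth x₀ a b z ^ 2 * (Real.sqrt (A z) * G z))
        = 4 * (annDepth x₀ a b z ^ 2 * Real.sqrt (A z)) * (annDepth x₀ a b z * G z) := by ring
      _ ≤ 4 * (10 ^ 4 * Sg₂) * (annDepth x₀ a b z * G z) := by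
          refine mul_le_mul_of_nonneg_right ?_ (mul_nonneg hd0 (hG0 z))
          linarith
      _ = 4 * 10 ^ 4 * Sg₂ * (annDepth x₀ a b z * G z) := by ring
  calc ∫⁻ τ in Ioc 0 (k⁻¹ / 2), ∫⁻ z in chainShell x₀ a b k τ, Φ₂ z
      = ∫⁻ z, ∫⁻ τ in Ioc 0 (k⁻¹ / 2), T.indicator 1 (τ, z) * Φ₂ z := by rw [h1, h2]
    _ ≤ ∫⁻ z, S''.indicator (fun z => ENNReal.ofReal (4 * annDepth x₀ a b z)) z * Φ₂ z :=
        lintegral_mono h3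
    _ = ∫⁻ z in S'', ENNReal.ofReal (4 * annDepth x₀ a b z) * Φ₂ z := by
        rw [← lintegral_indicator hS''m]
        refine lintegral_congr fun z => ?_
        by_cases hz : z ∈ S''
        · rw [indicator_of_mem hz, indicator_of_mem hz]
        · rw [indicator_of_notMem hz, indicator_of_notMem hz, zero_mul]
    _ ≤ ∫⁻ z in S'', ENNReal.ofReal (4 * 10 ^ 4 * Sg₂) * ENNReal.ofReal (annDepth x₀ a b z * G z) :=
        setLIntegral_mono' hS''m h4
    _ = ENNReal.ofReal (4 * 10 ^ 4 * Sg₂) * ∫⁻ z in S'', ENNReal.ofReal (annDepth x₀ a b z * G z) :=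
        lintegral_const_mul' _ _ ENNReal.ofReal_ne_top
    _ ≤ ENNReal.ofReal (4 * 10 ^ 4 * Sg₂) * ∫⁻ z in {z | 0 < annDepth x₀ a b z ∧ annDepth x₀ a b z ≤ k⁻¹},
          ENNReal.ofReal (annDepth x₀ a b z * G z) :=
        mul_le_mul' le_rfl (lintegral_mono_set fun z hz => ⟨hz.1, by linarith [hz.2]⟩)
    _ ≤ ENNReal.ofReal (4 * 10 ^ 4 * Sg₂) * ENNReal.ofReal (chainC₂ M / (M ^ 3 * k) * Y) := by
        refine mul_le_mul' le_rfl ?_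
        rw [hG, hY]
        exact lintegral_depth_whitneyAvg_layer_le' hk hM hM' (by fun_prop) fun x => sq_nonneg _
    _ = _ := by rw [← ENNReal.ofReal_mul (by positivity)]

/-- **Integrating the averaged transport inequality over the layer**:
`vol B(0,1/4) · (k⁻¹/4) ∫_{layer} Φ₁ ≤ Q₁ + (k⁻¹/4)·9V²·Q₂` with
`Qᵢ = ∫∫ 1_start(y,v) ∫_{Iᵢ} Φᵢ(y + τv) dτ dv dy`. [cite: Tao2011, §10, proof of Thm. 10.1 (p. 33, chaining of the wᵢ)] -/
theorem lintegral_layer_chainPhi₁_le_Q {f : ℝ³ → F} (hf : ContDiff ℝ 1 f) (hk : 0 < k) (ha : 0 < a)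
    (hab : a + 2 * k⁻¹ < b) (hM : 0 ≤ M) :
    volume (ball (0 : ℝ³) (1 / 4)) * (ENNReal.ofReal (k⁻¹ / 4) *
      ∫⁻ y in {y | 0 < annDepth x₀ a b y ∧ annDepth x₀ a b y < k⁻¹ / 8},
        ENNReal.ofReal (chainPhi₁ x₀ a b k M f y)) ≤
      (∫⁻ y, ∫⁻ v, (chainStart x₀ a b k).indicator 1 (y, v) *
        ∫⁻ τ in Ioc (k⁻¹ / 4) (k⁻¹ / 2), ENNReal.ofReal (chainPhi₁ x₀ a b k M f (y + τ • v))) +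
      ENNReal.ofReal (k⁻¹ / 4 * (9 * (5 / 4 * (1 + M / 100)) ^ 2)) *
        ∫⁻ y, ∫⁻ v, (chainStart x₀ a b k).indicator 1 (y, v) *
          ∫⁻ τ in Ioc 0 (k⁻¹ / 2), ENNReal.ofReal (chainPhi₂ x₀ a b k M f (y + τ • v)) := by
  have hℓ : 0 < k⁻¹ := inv_pos.2 hk
  set R₂ : Set ℝ³ := {y | 0 < annDepth x₀ a b y ∧ annDepth x₀ a b y < k⁻¹ / 8} with hR₂
  have hR₂m : MeasurableSet R₂ :=
    (measurableSet_lt measurable_const (continuous_annDepth x₀ a b).measurable).inter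
      (measurableSet_lt (continuous_annDepth x₀ a b).measurable measurable_const)
  set E := chainStart x₀ a b k with hE
  have hEm : MeasurableSet E := measurableSet_chainStart x₀ a b k
  set cE := ENNReal.ofReal (k⁻¹ / 4 * (9 * (5 / 4 * (1 + M / 100)) ^ 2)) with hcE
  set Φ₁ : ℝ³ → ℝ≥0∞ := fun z => ENNReal.ofReal (chainPhi₁ x₀ a b k M f z) with hΦ₁
  set Φ₂ : ℝ³ → ℝ≥0∞ := fun z => ENNReal.ofReal (chainPhi₂ x₀ a b k M f z) with hΦ₂
  have hΦ₁m : Measurable Φ₁ := ENNReal.measurable_ofReal.comp (continuous_chainPhi₁ hf).measurable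
  have hΦ₂m : Measurable Φ₂ := ENNReal.measurable_ofReal.comp (continuous_chainPhi₂ hf).measurable
  set T₁ : ℝ³ × ℝ³ → ℝ≥0∞ := fun p => ∫⁻ τ in Ioc (k⁻¹ / 4) (k⁻¹ / 2), Φ₁ (p.1 + τ • p.2) with hT₁
  set T₂ : ℝ³ × ℝ³ → ℝ≥0∞ := fun p => ∫⁻ τ in Ioc 0 (k⁻¹ / 2), Φ₂ (p.1 + τ • p.2) with hT₂
  have hmap : Measurable fun q : (ℝ³ × ℝ³) × ℝ => q.1.1 + q.2 • q.1.2 :=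
    ((continuous_fst.comp continuous_fst).add
      (continuous_snd.smul (continuous_snd.comp continuous_fst))).measurable
  have hT₁m : Measurable T₁ := (hΦ₁m.comp hmap).lintegral_prod_right'
  have hT₂m : Measurable T₂ := (hΦ₂m.comp hmap).lintegral_prod_right'
  have hw : Measurable (E.indicator (1 : ℝ³ × ℝ³ → ℝ≥0∞)) := measurable_one.indicator hEm
  -- pointwise in `y`
  have hpt : ∀ y ∈ R₂, volume (ball (0 : ℝ³) (1 / 4)) * (ENNReal.ofReal (k⁻¹ / 4) * Φ₁ y) ≤
      ∫⁻ v, E.indicator 1 (y, v) * (T₁ (y, v) + cE * T₂ (y, v)) := by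
    intro y hy
    have hvol : volume (ball (0 : ℝ³) (1 / 4)) = volume (ball (inwardDir x₀ a b y) (1 / 4)) := by
      rw [volume_ball_eq _ (by norm_num), volume_ball_eq (inwardDir x₀ a b y) (by norm_num)]
    calc volume (ball (0 : ℝ³) (1 / 4)) * (ENNReal.ofReal (k⁻¹ / 4) * Φ₁ y)
        = ∫⁻ _ in ball (inwardDir x₀ a b y) (1 / 4), ENNReal.ofReal (k⁻¹ / 4) * Φ₁ y := by
          rw [setLIntegral_const, hvol, mul_comm]
      _ ≤ ∫⁻ v in ball (inwardDir x₀ a b y) (1 / 4), (T₁ (y, v) + cE * T₂ (y, v)) := by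
          refine setLIntegral_mono' measurableSet_ball fun v hv => ?_
          rw [hΦ₁, ← ENNReal.ofReal_mul (by positivity)]
          exact lintegral_transport_of_mem_layer hf hk ha hab hM hy.1 hy.2 hv
      _ = ∫⁻ v, (ball (inwardDir x₀ a b y) (1 / 4)).indicator (fun v => T₁ (y, v) + cE * T₂ (y, v)) v :=
          (lintegral_indicator measurableSet_ball _).symm
      _ = ∫⁻ v, E.indicator 1 (y, v) * (T₁ (y, v) + cE * T₂ (y, v)) := by
          refine lintegral_congr fun v => ?_
          by_cases hv : v ∈ ball (inwardDir x₀ a b y) (1 / 4)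
          · rw [indicator_of_mem hv, indicator_of_mem (show (y, v) ∈ E from ⟨hy, mem_ball.1 hv⟩),
              Pi.one_apply, one_mul]
          · rw [indicator_of_notMem hv, indicator_of_notMem (fun h : (y, v) ∈ E => hv (mem_ball.2 h.2)),
              zero_mul]
  -- splitting the right-hand side
  have hsplit : ∀ y, ∫⁻ v, E.indicator 1 (y, v) * (T₁ (y, v) + cE * T₂ (y, v)) =
      (∫⁻ v, E.indicator 1 (y, v) * T₁ (y, v)) + cE * ∫⁻ v, E.indicator 1 (y, v) * T₂ (y, v) := by
    intro y
    have hm1 : Measurable fun v => E.indicator 1 (y, v) * T₁ (y, v) :=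
      (hw.comp measurable_prodMk_left).mul (hT₁m.comp measurable_prodMk_left)
    rw [← lintegral_const_mul' _ _ ENNReal.ofReal_ne_top, ← lintegral_add_left hm1]
    refine lintegral_congr fun v => ?_
    ring
  have hm2 : Measurable fun y => ∫⁻ v, E.indicator 1 (y, v) * T₁ (y, v) := by
    have : Measurable fun p : ℝ³ × ℝ³ => E.indicator 1 p * T₁ p := hw.mul hT₁m
    exact this.lintegral_prod_right'
  calc volume (ball (0 : ℝ³) (1 / 4)) * (ENNReal.ofReal (k⁻¹ / 4) * ∫⁻ y in R₂, Φ₁ y)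
      = ∫⁻ y in R₂, volume (ball (0 : ℝ³) (1 / 4)) * (ENNReal.ofReal (k⁻¹ / 4) * Φ₁ y) := by
        rw [lintegral_const_mul' _ _ measure_ball_lt_top.ne, lintegral_const_mul' _ _ ENNReal.ofReal_ne_top]
    _ ≤ ∫⁻ y in R₂, ∫⁻ v, E.indicator 1 (y, v) * (T₁ (y, v) + cE * T₂ (y, v)) :=
        setLIntegral_mono' hR₂m hpt
    _ ≤ ∫⁻ y, ∫⁻ v, E.indicator 1 (y, v) * (T₁ (y, v) + cE * T₂ (y, v)) := setLIntegral_le_lintegral _ _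
    _ = ∫⁻ y, ((∫⁻ v, E.indicator 1 (y, v) * T₁ (y, v)) + cE * ∫⁻ v, E.indicator 1 (y, v) * T₂ (y, v)) :=
        lintegral_congr hsplit
    _ = (∫⁻ y, ∫⁻ v, E.indicator 1 (y, v) * T₁ (y, v)) +
          cE * ∫⁻ y, ∫⁻ v, E.indicator 1 (y, v) * T₂ (y, v) := by
        rw [lintegral_add_left hm2, lintegral_const_mul' _ _ ENNReal.ofReal_ne_top]

/-- **The layer estimate** (`ℝ≥0∞` form, raw constants): `∫_{0 < d < k⁻¹/8} Φ₁ ≤ (vol B(0,1/4) k⁻¹/4)⁻¹ ·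
(vol B̄(0,5/4) · TermI + (k⁻¹/4)·9V² · vol B̄(0,5/4) · TermII)`. [cite: Tao2011, §10, proof of Thm. 10.1 (p. 33, chaining of the wᵢ)] -/
theorem lintegral_layer_chainPhi₁_le {f : ℝ³ → F} (hf : ContDiff ℝ 1 f) (hk : 0 < k) (ha : 0 < a)
    (hab : a + 2 * k⁻¹ < b) (hM : 0 < M) (hM' : M ≤ 50) :
    ∫⁻ y in {y | 0 < annDepth x₀ a b y ∧ annDepth x₀ a b y < k⁻¹ / 8},
        ENNReal.ofReal (chainPhi₁ x₀ a b k M f y) ≤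
      ENNReal.ofReal (256 * k / unitBallVol * ((5 / 4) ^ 3 * unitBallVol) *
        (k⁻¹ / 4 * (3 * k⁻¹ / 4 *
          (Real.sqrt ((∫ x, ‖f x‖ ^ 2 * annularRamp k a b ‖x - x₀‖) * k ^ 3) * (1600 ^ 2 * chainS₀ M)) *
          (32 * chainC₃ M / M ^ 3 * ∫ x, ‖f x‖ ^ 2 * annularRamp k a b ‖x - x₀‖)))) +
      ENNReal.ofReal (256 * k / unitBallVol * (k⁻¹ / 4 * (9 * (5 / 4 * (1 + M / 100)) ^ 2)) *
        ((5 / 4) ^ 3 * unitBallVol) *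
        (4 * 10 ^ 4 * (Real.sqrt ((∫ x, ‖f x‖ ^ 2 * annularRamp k a b ‖x - x₀‖) / k) * chainS₀ M) *
          (chainC₂ M / (M ^ 3 * k) * ∫ x, ‖fderiv ℝ f x‖ ^ 2 * annularRamp k a b ‖x - x₀‖))) := by
  have hℓ : 0 < k⁻¹ := inv_pos.2 hk
  have hκ := unitBallVol_pos
  have hΦ₁m : Measurable fun z => ENNReal.ofReal (chainPhi₁ x₀ a b k M f z) :=
    ENNReal.measurable_ofReal.comp (continuous_chainPhi₁ hf).measurable
  have hΦ₂m : Measurable fun z => ENNReal.ofReal (chainPhi₂ x₀ a b k M f z) :=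
    ENNReal.measurable_ofReal.comp (continuous_chainPhi₂ hf).measurable
  have hQ := lintegral_layer_chainPhi₁_le_Q (x₀ := x₀) hf hk ha hab hM.le
  have hF₁ := lintegral_lintegral_chainStart_le (x₀ := x₀) hk ha hab (I := Ioc (k⁻¹ / 4) (k⁻¹ / 2))
    (fun τ hτ => ⟨by linarith [hτ.1], hτ.2⟩) measurableSet_Ioc hΦ₁m
  have hF₂ := lintegral_lintegral_chainStart_le (x₀ := x₀) hk ha hab (I := Ioc 0 (k⁻¹ / 2))
    (fun τ hτ => ⟨hτ.1.le, hτ.2⟩) measurableSet_Ioc hΦ₂m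
  have hI₁ := lintegral_shell_chainPhi₁_le (x₀ := x₀) (a := a) (b := b) hf hk hM hM'
  have hI₂ := lintegral_shell_chainPhi₂_le (x₀ := x₀) (a := a) (b := b) hf hk hM hM'
  set X := ∫⁻ y in {y | 0 < annDepth x₀ a b y ∧ annDepth x₀ a b y < k⁻¹ / 8},
    ENNReal.ofReal (chainPhi₁ x₀ a b k M f y) with hX
  set X₁ : ℝ := k⁻¹ / 4 * (3 * k⁻¹ / 4 *
    (Real.sqrt ((∫ x, ‖f x‖ ^ 2 * annularRamp k a b ‖x - x₀‖) * k ^ 3) * (1600 ^ 2 * chainS₀ M)) *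
    (32 * chainC₃ M / M ^ 3 * ∫ x, ‖f x‖ ^ 2 * annularRamp k a b ‖x - x₀‖)) with hX₁
  set X₂ : ℝ := 4 * 10 ^ 4 * (Real.sqrt ((∫ x, ‖f x‖ ^ 2 * annularRamp k a b ‖x - x₀‖) / k) * chainS₀ M) *
    (chainC₂ M / (M ^ 3 * k) * ∫ x, ‖fderiv ℝ f x‖ ^ 2 * annularRamp k a b ‖x - x₀‖) with hX₂
  set cr : ℝ := k⁻¹ / 4 * (9 * (5 / 4 * (1 + M / 100)) ^ 2) with hcr
  have hcr0 : 0 ≤ cr := by rw [hcr]; positivity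
  set β₅ := volume (closedBall (0 : ℝ³) (5 / 4)) with hβ₅
  have hβ₅' : β₅ = ENNReal.ofReal ((5 / 4) ^ 3 * unitBallVol) := volume_closedBall_eq_ofReal 0 (by norm_num)
  set γ := volume (ball (0 : ℝ³) (1 / 4)) * ENNReal.ofReal (k⁻¹ / 4) with hγ
  have hγ' : γ = ENNReal.ofReal (unitBallVol / (256 * k)) := by
    rw [hγ, volume_ball_eq_ofReal 0 (by norm_num), ← ENNReal.ofReal_mul (by positivity)]
    congr 1
    field_simp
    norm_num
  have hγpos : 0 < unitBallVol / (256 * k) := by positivity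
  have hγinv : γ⁻¹ = ENNReal.ofReal (256 * k / unitBallVol) := by
    rw [hγ', ← ENNReal.ofReal_inv_of_pos hγpos, inv_div]
  have key : γ * X ≤ β₅ * ENNReal.ofReal X₁ + ENNReal.ofReal cr * (β₅ * ENNReal.ofReal X₂) := by
    rw [hγ, mul_assoc]
    refine hQ.trans (add_le_add (hF₁.trans (mul_le_mul' le_rfl hI₁)) ?_)
    exact mul_le_mul' le_rfl (hF₂.trans (mul_le_mul' le_rfl hI₂))
  have hγ0 : γ ≠ 0 := by rw [hγ']; exact (ENNReal.ofReal_pos.2 hγpos).ne'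
  have hγtop : γ ≠ ⊤ := by rw [hγ']; exact ENNReal.ofReal_ne_top
  calc X = γ⁻¹ * (γ * X) := by rw [← mul_assoc, ENNReal.inv_mul_cancel hγ0 hγtop, one_mul]
    _ ≤ γ⁻¹ * (β₅ * ENNReal.ofReal X₁ + ENNReal.ofReal cr * (β₅ * ENNReal.ofReal X₂)) :=
        mul_le_mul' le_rfl key
    _ = _ := by
        rw [mul_add, hγinv, hβ₅']
        have hA1 : (0:ℝ) ≤ 256 * k / unitBallVol * ((5 / 4) ^ 3 * unitBallVol) := by positivity
        have hA2 : (0:ℝ) ≤ 256 * k / unitBallVol * cr * ((5 / 4) ^ 3 * unitBallVol) := by positivity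
        have hA3 : (0:ℝ) ≤ 256 * k / unitBallVol * cr := by positivity
        have hA4 : (0:ℝ) ≤ 256 * k / unitBallVol := by positivity
        symm
        rw [ENNReal.ofReal_mul hA1, ENNReal.ofReal_mul hA2, ENNReal.ofReal_mul hA3, ENNReal.ofReal_mul hA4,
          ENNReal.ofReal_mul hA4]
        ring

omit [InnerProductSpace ℝ F] in
/-- **The plateau part** `d ≥ k⁻¹/8`: there `kρ ≤ 1/100` and `A^{1/2} ≤ (Wk³)^{1/2} 1600² s₀`, so
`∫_{d ≥ k⁻¹/8} kρ A^{3/2} ≤ (1/100)(Wk³)^{1/2} 1600² s₀ · 32 c₃/M³ · W`. [cite: Tao2011, §10, proof of Thm. 10.1 (p. 33, the large balls: "(10.22) and (10.23)")] -/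
theorem lintegral_plateau_le {f : ℝ³ → F} (hf : Continuous f) (hk : 0 < k) (hM : 0 < M) (hM' : M ≤ 50) :
    ∫⁻ y in {y | k⁻¹ / 8 ≤ annDepth x₀ a b y}, ENNReal.ofReal (k * (whitneyRadius x₀ a b k y *
        (whitneyAvg x₀ a b k M (fun x => ‖f x‖ ^ 2) y *
          Real.sqrt (whitneyAvg x₀ a b k M (fun x => ‖f x‖ ^ 2) y)))) ≤
      ENNReal.ofReal (1 / 100 *
        (Real.sqrt ((∫ x, ‖f x‖ ^ 2 * annularRamp k a b ‖x - x₀‖) * k ^ 3) * (1600 ^ 2 * chainS₀ M)) *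
        (32 * chainC₃ M / M ^ 3 * ∫ x, ‖f x‖ ^ 2 * annularRamp k a b ‖x - x₀‖)) := by
  have hℓ : 0 < k⁻¹ := inv_pos.2 hk
  set W := ∫ x, ‖f x‖ ^ 2 * annularRamp k a b ‖x - x₀‖ with hW
  set Sg₁ : ℝ := Real.sqrt (W * k ^ 3) * (1600 ^ 2 * chainS₀ M) with hSg₁
  have hSg₁0 : 0 ≤ Sg₁ := mul_nonneg (Real.sqrt_nonneg _) (mul_nonneg (by norm_num) (chainS₀_nonneg M))
  set A := whitneyAvg x₀ a b k M (fun x => ‖f x‖ ^ 2) with hA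
  have hA0 : ∀ z, 0 ≤ A z := fun z => whitneyAvg_nonneg (fun _ => sq_nonneg _) z
  set R₁ : Set ℝ³ := {y | k⁻¹ / 8 ≤ annDepth x₀ a b y} with hR₁
  have hR₁m : MeasurableSet R₁ :=
    (isClosed_le continuous_const (continuous_annDepth x₀ a b)).measurableSet
  have hpt : ∀ y ∈ R₁, ENNReal.ofReal (k * (whitneyRadius x₀ a b k y * (A y * Real.sqrt (A y)))) ≤
      ENNReal.ofReal (1 / 100 * Sg₁) * ENNReal.ofReal (A y) := by
    intro y hy
    rw [← ENNReal.ofReal_mul (by positivity)]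
    refine ENNReal.ofReal_le_ofReal ?_
    have hy' : k⁻¹ / 16 ≤ annDepth x₀ a b y := le_trans (by linarith : k⁻¹ / 16 ≤ k⁻¹ / 8) hy
    have hsq : Real.sqrt (A y) ≤ Sg₁ := by
      rw [hSg₁, hA, hW]; exact sqrt_whitneyAvg_le_plateau hk hM hM' hf hy'
    have hρ := whitneyRadius_le_inv_div (x₀ := x₀) (a := a) (b := b) hk y
    have hρ0 := whitneyRadius_nonneg x₀ a b k y
    have hkρ : k * whitneyRadius x₀ a b k y ≤ 1 / 100 := by
      calc k * whitneyRadius x₀ a b k y ≤ k * (k⁻¹ / 100) := mul_le_mul_of_nonneg_left hρ hk.le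
        _ = 1 / 100 := by field_simp
    calc k * (whitneyRadius x₀ a b k y * (A y * Real.sqrt (A y)))
        = (k * whitneyRadius x₀ a b k y) * (A y * Real.sqrt (A y)) := by ring
      _ ≤ (1 / 100) * (A y * Sg₁) :=
          mul_le_mul hkρ (mul_le_mul_of_nonneg_left hsq (hA0 y))
            (mul_nonneg (hA0 y) (Real.sqrt_nonneg _)) (by norm_num)
      _ = 1 / 100 * Sg₁ * A y := by ring
  calc ∫⁻ y in R₁, ENNReal.ofReal (k * (whitneyRadius x₀ a b k y * (A y * Real.sqrt (A y))))
      ≤ ∫⁻ y in R₁, ENNReal.ofReal (1 / 100 * Sg₁) * ENNReal.ofReal (A y) := setLIntegral_mono' hR₁m hpt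
    _ = ENNReal.ofReal (1 / 100 * Sg₁) * ∫⁻ y in R₁, ENNReal.ofReal (A y) :=
        lintegral_const_mul' _ _ ENNReal.ofReal_ne_top
    _ ≤ ENNReal.ofReal (1 / 100 * Sg₁) * ∫⁻ y in {z | k⁻¹ / 16 ≤ annDepth x₀ a b z}, ENNReal.ofReal (A y) :=
        mul_le_mul' le_rfl (lintegral_mono_set fun y hy => le_trans (by linarith : k⁻¹ / 16 ≤ k⁻¹ / 8) hy)
    _ ≤ ENNReal.ofReal (1 / 100 * Sg₁) * ENNReal.ofReal (32 * chainC₃ M / M ^ 3 * W) := by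
        refine mul_le_mul' le_rfl ?_
        rw [hA, hW]
        exact lintegral_whitneyAvg_plateau_le' hk hM hM' (by fun_prop) fun x => sq_nonneg _
    _ = _ := by rw [← ENNReal.ofReal_mul (by positivity)]

/-- The constant of the `W^{3/2}` term of the chaining estimate. [folklore] -/
def chainK₁ (M : ℝ) : ℝ := (30 + 8 / 25) * 1600 ^ 2 * chainS₀ M * chainC₃ M / M ^ 3

/-- The constant of the `W^{1/2} Y` term of the chaining estimate. [folklore] -/
def chainK₂ (M : ℝ) : ℝ := 450000 * (5 / 4 * (1 + M / 100)) ^ 2 * chainS₀ M * chainC₂ M / M ^ 3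

/-- `K₁ ≥ 0` (`0 < M ≤ 50`). [folklore] -/
theorem chainK₁_nonneg (hM : 0 < M) (hM' : M ≤ 50) : 0 ≤ chainK₁ M := by
  have := chainS₀_nonneg M; have := chainC₃_nonneg hM.le hM'
  unfold chainK₁; positivity

/-- `K₂ ≥ 0` (`0 < M ≤ 50`). [folklore] -/
theorem chainK₂_nonneg (hM : 0 < M) (hM' : M ≤ 50) : 0 ≤ chainK₂ M := by
  have := chainS₀_nonneg M; have := chainC₂_nonneg hM.le hM'
  unfold chainK₂; positivity

omit [InnerProductSpace ℝ F] in
/-- The integrand of the chaining estimate is nonnegative. [folklore] -/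
theorem whitneyRadius_mul_whitneyAvg_nonneg (f : ℝ³ → F) (y : ℝ³) :
    0 ≤ whitneyRadius x₀ a b k y * (whitneyAvg x₀ a b k M (fun x => ‖f x‖ ^ 2) y *
      Real.sqrt (whitneyAvg x₀ a b k M (fun x => ‖f x‖ ^ 2) y)) :=
  mul_nonneg (whitneyRadius_nonneg _ _ _ _ _)
    (mul_nonneg (whitneyAvg_nonneg (fun _ => sq_nonneg _) _) (Real.sqrt_nonneg _))

omit [InnerProductSpace ℝ F] in
/-- The integrand of the chaining estimate is continuous (`f` continuous). [folklore] -/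
theorem continuous_whitneyRadius_mul_whitneyAvg {f : ℝ³ → F} (hf : Continuous f) :
    Continuous fun y => whitneyRadius x₀ a b k y * (whitneyAvg x₀ a b k M (fun x => ‖f x‖ ^ 2) y *
      Real.sqrt (whitneyAvg x₀ a b k M (fun x => ‖f x‖ ^ 2) y)) := by
  have hA : Continuous (whitneyAvg x₀ a b k M (fun x => ‖f x‖ ^ 2)) :=
    continuous_whitneyAvg (hf.norm.pow 2)
  exact (continuous_whitneyRadius x₀ a b k).mul (hA.mul hA.sqrt)

omit [InnerProductSpace ℝ F] in
/-- The integrand of the chaining estimate is integrable on the open annulus. [folklore] -/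
theorem integrableOn_whitneyRadius_mul_whitneyAvg {f : ℝ³ → F} (hf : Continuous f) :
    IntegrableOn (fun y => whitneyRadius x₀ a b k y * (whitneyAvg x₀ a b k M (fun x => ‖f x‖ ^ 2) y *
      Real.sqrt (whitneyAvg x₀ a b k M (fun x => ‖f x‖ ^ 2) y))) {y | 0 < annDepth x₀ a b y} := by
  refine ((continuous_whitneyRadius_mul_whitneyAvg hf).continuousOn.integrableOn_compact
    (isCompact_closedBall x₀ b)).mono_set fun y hy => ?_
  rw [mem_setOf_eq, annDepth_pos_iff] at hy
  exact mem_closedBall.2 (by rw [dist_eq_norm]; exact hy.2.le)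

/-- **Tao 2011, proof of Thm. 10.1, the chaining estimate for the Whitney averages — continuous
radial version.** For `f ∈ C¹(ℝ³)`, the annulus `a < |x − x₀| < b` with `0 < a`,
`a + 2k⁻¹ < b`, the Lipschitz cutoff `η = annularRamp k a b |· − x₀|` of slope `k`, the Whitney
radius `ρ = min(d, k⁻¹)/100` and the Whitney averages `A = ⨍_{B(·, Mρ)} ‖f‖²` (`0 < M ≤ 50`):

  `k ∫_Ω ρ A^{3/2} ≤ K₁(M) (W k³)^{1/2} W + K₂(M) (W/k)^{1/2} Y`,
  `W = ∫ ‖f‖² η`, `Y = ∫ ‖Df‖² η`.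

This is the continuous form of Tao's bound for the second term of (10.21),
"`c^{-0.1}δ² Σᵢ rᵢ⁴wᵢ³ ≲ c^{-0.15}δ³W^{3/2} + c^{0.05}δ^{-1}W^{1/2}Y₁`" (arXiv p. 33, with
`k = c^{-0.1}δ²`, `Σᵢ rᵢ⁴wᵢ³ ↔ ∫ ρ(y)⁻³ · ρ⁴ A^{3/2} dy`), obtained there by the parent-ball
chaining with Poincaré's inequality; here by transporting the averages along straight inward
paths (`ballAvg_transport`), averaging over endpoints and directions, translation invariance and
the overlap bounds of the continuous Whitney decomposition. [cite: Tao2011, §10, proof of Thm. 10.1 (arXiv p. 33, (10.21)–(10.23) and the chaining argument) + Remark 10.6] -/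
theorem whitney_radial_chaining {f : ℝ³ → F} (hf : ContDiff ℝ 1 f) (hk : 0 < k) (ha : 0 < a)
    (hab : a + 2 * k⁻¹ < b) (hM : 0 < M) (hM' : M ≤ 50) :
    k * ∫ y in {y | 0 < annDepth x₀ a b y}, whitneyRadius x₀ a b k y *
        (whitneyAvg x₀ a b k M (fun x => ‖f x‖ ^ 2) y *
          Real.sqrt (whitneyAvg x₀ a b k M (fun x => ‖f x‖ ^ 2) y)) ≤
      chainK₁ M * (Real.sqrt ((∫ x, ‖f x‖ ^ 2 * annularRamp k a b ‖x - x₀‖) * k ^ 3) *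
          ∫ x, ‖f x‖ ^ 2 * annularRamp k a b ‖x - x₀‖) +
        chainK₂ M * (Real.sqrt ((∫ x, ‖f x‖ ^ 2 * annularRamp k a b ‖x - x₀‖) / k) *
          ∫ x, ‖fderiv ℝ f x‖ ^ 2 * annularRamp k a b ‖x - x₀‖) := by
  have hℓ : 0 < k⁻¹ := inv_pos.2 hk
  have hκ := unitBallVol_pos
  have hfc := hf.continuous
  set W := ∫ x, ‖f x‖ ^ 2 * annularRamp k a b ‖x - x₀‖ with hW
  set Y := ∫ x, ‖fderiv ℝ f x‖ ^ 2 * annularRamp k a b ‖x - x₀‖ with hY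
  have hW0 : 0 ≤ W := integral_nonneg fun x => mul_nonneg (sq_nonneg _) (annularRamp_nonneg _ _ _ _)
  have hY0 : 0 ≤ Y := integral_nonneg fun x => mul_nonneg (sq_nonneg _) (annularRamp_nonneg _ _ _ _)
  set A := whitneyAvg x₀ a b k M (fun x => ‖f x‖ ^ 2) with hA
  set g : ℝ³ → ℝ := fun y => whitneyRadius x₀ a b k y * (A y * Real.sqrt (A y)) with hg
  have hg0 : ∀ y, 0 ≤ g y := fun y => whitneyRadius_mul_whitneyAvg_nonneg f y
  set Ω : Set ℝ³ := {y | 0 < annDepth x₀ a b y} with hΩ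
  set R₁ : Set ℝ³ := {y | k⁻¹ / 8 ≤ annDepth x₀ a b y} with hR₁
  set R₂ : Set ℝ³ := {y | 0 < annDepth x₀ a b y ∧ annDepth x₀ a b y < k⁻¹ / 8} with hR₂
  have hR₁m : MeasurableSet R₁ := (isClosed_le continuous_const (continuous_annDepth x₀ a b)).measurableSet
  have hR₂m : MeasurableSet R₂ :=
    (measurableSet_lt measurable_const (continuous_annDepth x₀ a b).measurable).inter
      (measurableSet_lt (continuous_annDepth x₀ a b).measurable measurable_const)
  have hΩeq : Ω = R₂ ∪ R₁ := by
    ext y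
    simp only [hΩ, hR₁, hR₂, mem_setOf_eq, mem_union]
    constructor
    · intro hy
      rcases lt_or_ge (annDepth x₀ a b y) (k⁻¹ / 8) with h | h
      · exact Or.inl ⟨hy, h⟩
      · exact Or.inr h
    · rintro (h | h)
      · exact h.1
      · linarith
  have hdisj : Disjoint R₂ R₁ := by
    rw [disjoint_left]
    intro y hy hy'
    have : k⁻¹ / 8 ≤ annDepth x₀ a b y := hy'
    linarith [hy.2]
  -- the three real terms
  set P₁ : ℝ := 256 * k / unitBallVol * ((5 / 4) ^ 3 * unitBallVol) *
    (k⁻¹ / 4 * (3 * k⁻¹ / 4 * (Real.sqrt (W * k ^ 3) * (1600 ^ 2 * chainS₀ M)) *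
      (32 * chainC₃ M / M ^ 3 * W))) with hP₁
  set P₂ : ℝ := 256 * k / unitBallVol * (k⁻¹ / 4 * (9 * (5 / 4 * (1 + M / 100)) ^ 2)) *
    ((5 / 4) ^ 3 * unitBallVol) * (4 * 10 ^ 4 * (Real.sqrt (W / k) * chainS₀ M) *
      (chainC₂ M / (M ^ 3 * k) * Y)) with hP₂
  set P₃ : ℝ := 1 / 100 * (Real.sqrt (W * k ^ 3) * (1600 ^ 2 * chainS₀ M)) *
    (32 * chainC₃ M / M ^ 3 * W) with hP₃
  have hs₀ := chainS₀_nonneg M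
  have hc₃ := chainC₃_nonneg hM.le hM'
  have hc₂ := chainC₂_nonneg hM.le hM'
  have hP₁0 : 0 ≤ P₁ := by rw [hP₁]; positivity
  have hP₂0 : 0 ≤ P₂ := by rw [hP₂]; positivity
  have hP₃0 : 0 ≤ P₃ := by rw [hP₃]; positivity
  -- the layer
  have hlayer : ∫⁻ y in R₂, ENNReal.ofReal (k * g y) ≤
      ENNReal.ofReal (k / 100 * P₁) + ENNReal.ofReal (k / 100 * P₂) := by
    have hL := lintegral_layer_chainPhi₁_le (x₀ := x₀) hf hk ha hab hM hM'
    rw [← hW, ← hY, ← hP₁, ← hP₂] at hL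
    have e : ∀ y ∈ R₂, ENNReal.ofReal (k * g y) =
        ENNReal.ofReal (k / 100) * ENNReal.ofReal (chainPhi₁ x₀ a b k M f y) := by
      intro y hy
      rw [← ENNReal.ofReal_mul (by positivity), chainPhi₁_def, ← hA, hg]
      congr 1
      simp only
      rw [whitneyRadius_eq_of_le hy.1.le (by linarith [hy.2])]
      ring
    rw [setLIntegral_congr_fun hR₂m e, lintegral_const_mul' _ _ ENNReal.ofReal_ne_top]
    refine (mul_le_mul' le_rfl hL).trans (le_of_eq ?_)
    rw [mul_add, ← ENNReal.ofReal_mul (by positivity), ← ENNReal.ofReal_mul (by positivity)]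
  -- the plateau
  have hplateau : ∫⁻ y in R₁, ENNReal.ofReal (k * g y) ≤ ENNReal.ofReal P₃ := by
    have := lintegral_plateau_le (x₀ := x₀) (a := a) (b := b) (M := M) hfc hk hM hM'
    rw [← hW] at this
    exact this
  -- the whole annulus, in `ℝ≥0∞`
  have hint := integrableOn_whitneyRadius_mul_whitneyAvg (x₀ := x₀) (a := a) (b := b) (k := k) (M := M) hfc
  have htot : ENNReal.ofReal (k * ∫ y in Ω, g y) ≤ ENNReal.ofReal (k / 100 * P₁ + k / 100 * P₂ + P₃) := by
    have e1 : ENNReal.ofReal (k * ∫ y in Ω, g y) = ∫⁻ y in Ω, ENNReal.ofReal (k * g y) := by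
      rw [← integral_const_mul, ofReal_integral_eq_lintegral_ofReal (hint.const_mul k)
        (Eventually.of_forall fun y => mul_nonneg hk.le (hg0 y))]
    rw [e1, hΩeq, lintegral_union hR₁m hdisj, ENNReal.ofReal_add (by positivity) hP₃0,
      ENNReal.ofReal_add (by positivity) (by positivity)]
    exact add_le_add hlayer hplateau
  -- back to `ℝ`
  have hreal : k / 100 * P₁ + k / 100 * P₂ + P₃ =
      chainK₁ M * (Real.sqrt (W * k ^ 3) * W) + chainK₂ M * (Real.sqrt (W / k) * Y) := by
    rw [hP₁, hP₂, hP₃, chainK₁, chainK₂]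
    field_simp
    ring
  have hRHS0 : 0 ≤ chainK₁ M * (Real.sqrt (W * k ^ 3) * W) + chainK₂ M * (Real.sqrt (W / k) * Y) := by
    rw [← hreal]; positivity
  rw [hreal] at htot
  exact (ENNReal.ofReal_le_ofReal_iff hRHS0).1 htot

/-- **The chaining estimate for the vorticity** `ω = curl u` of a `C²` field, in Tao's
quantities `W = ½∫|ω|²η` (`localisedEnstrophy`) and `Y₁ = ∫|∇ω|²_F η`
(`localisedEnstrophyDissipation`; the Frobenius norm dominates the operator norm):
`k ∫_Ω ρ A_ω^{3/2} ≤ K₁(M) (2Wk³)^{1/2}(2W) + K₂(M) (2W/k)^{1/2} Y₁`. This is the input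
"`c^{-0.1}δ² Σᵢ rᵢ⁴wᵢ³ ≲ c^{-0.15}δ³W^{3/2} + c^{0.05}δ^{-1}W^{1/2}Y₁`" of the `Y₆,₁` bound. [cite: Tao2011, §10, proof of Thm. 10.1 (arXiv p. 33, (10.21)–(10.23)) + Remark 10.6] -/
theorem whitney_radial_chaining_curl {u : ℝ³ → ℝ³} (hu : ContDiff ℝ 2 u) (hk : 0 < k) (ha : 0 < a)
    (hab : a + 2 * k⁻¹ < b) (hM : 0 < M) (hM' : M ≤ 50) :
    k * ∫ y in {y | 0 < annDepth x₀ a b y}, whitneyRadius x₀ a b k y *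
        (whitneyAvg x₀ a b k M (fun x => ‖curl u x‖ ^ 2) y *
          Real.sqrt (whitneyAvg x₀ a b k M (fun x => ‖curl u x‖ ^ 2) y)) ≤
      chainK₁ M * (Real.sqrt (2 * localisedEnstrophy (fun x => annularRamp k a b ‖x - x₀‖) u * k ^ 3) *
          (2 * localisedEnstrophy (fun x => annularRamp k a b ‖x - x₀‖) u)) +
        chainK₂ M * (Real.sqrt (2 * localisedEnstrophy (fun x => annularRamp k a b ‖x - x₀‖) u / k) *
          localisedEnstrophyDissipation (fun x => annularRamp k a b ‖x - x₀‖) u) := by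
  have hω : ContDiff ℝ 1 (curl u) := contDiff_curl (n := 1) hu
  have h := whitney_radial_chaining (x₀ := x₀) (F := ℝ³) hω hk ha hab hM hM'
  have hW : (∫ x, ‖curl u x‖ ^ 2 * annularRamp k a b ‖x - x₀‖) =
      2 * localisedEnstrophy (fun x => annularRamp k a b ‖x - x₀‖) u := by
    rw [localisedEnstrophy_def]; ring
  have hY : (∫ x, ‖fderiv ℝ (curl u) x‖ ^ 2 * annularRamp k a b ‖x - x₀‖) ≤
      localisedEnstrophyDissipation (fun x => annularRamp k a b ‖x - x₀‖) u := by
    rw [localisedEnstrophyDissipation_def]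
    refine integral_mono (integrable_mul_annularRamp hk.le ((hω.continuous_fderiv one_ne_zero).norm.pow 2))
      (integrable_mul_annularRamp hk.le (continuous_frobeniusNormSq_fderiv hω one_ne_zero)) fun x => ?_
    exact mul_le_mul_of_nonneg_right (sq_opNorm_le_frobeniusNormSq _) (annularRamp_nonneg _ _ _ _)
  rw [hW] at h
  refine h.trans (add_le_add le_rfl (mul_le_mul_of_nonneg_left
    (mul_le_mul_of_nonneg_left hY (Real.sqrt_nonneg _)) (chainK₂_nonneg hM hM')))

end Assembly

end Literature.Analysis.FluidPDE

end
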